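import Mathlib.LinearAlgebra.QuadraticForm.Basic
import Mathlib.Topology.Algebra.MvPolynomial
import Literature.MathematicalPhysics.QuantumFieldTheory.OSAxiomsFreeFieldRPProofs
import Literature.MathematicalPhysics.QuantumFieldTheory.OSAxiomsFreeFieldErgodicProofs
import Literature.MathematicalPhysics.QuantumFieldTheory.GaussianFieldOfCovariance
import Literature.MathematicalPhysics.QuantumFieldTheory.OSData
import Literature.MathematicalPhysics.QuantumLattice.SchwingerOSCluster
import Literature.Probability.Distributions.GaussianMaximalCorrelation
import HarnessLib

/-!
# The mass gap of the free scalar field: exponential clustering of ALL truncated Schwinger functions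

Topic `MathematicalPhysics/QuantumFieldTheory` (families `constructive-qft`, `yang-mills`). Proofs-only
file (no named facts). Main results:

* `IsFreeField.massGapOS` — for the free Euclidean field `μ` of mass `m > 0` on `𝒮'(ℝ^d)` and any
  Euclidean-covariant Schwinger family `𝔖` of `μ` (`IsSchwingerFamilyOf μ 𝔖`): `𝔖.MassGapOS m`, i.e.
  for ALL positive-time (in particular time-ordered) `F ∈ 𝒮((ℝ^d)ⁿ)`, `G ∈ 𝒮((ℝ^d)ᵏ)` there is
  `C = 4 N(F)^{1/2} N(G)^{1/2}` with `‖𝔖ₙ₊ₖ(ΘF* ⊗ T_t G) − 𝔖ₙ(ΘF*) 𝔖ₖ(G)‖ ≤ C e^{−mt}` (`t ≥ 0`);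
  `IsFreeField.hasMassGap_toLabelled` — the same in the labelled (`OSData`) form
  `𝔖.toLabelled.HasMassGap m`. This is the "mass gap `m`" clause (iii) listed as missing in
  `IsotropicOSFamilyExists` (all truncations, not only the two-point function of
  `IsFreeField.hasExponentialClustering_holds`).
* `abs_freeCovarianceReal_timeShiftTest_le_exp` — the sharp one-particle bound
  `|C_m(f, T_t g)| ≤ e^{−mt} C_m(f,f)^{1/2} C_m(g,g)^{1/2}` for `f` negative-time, `g` positive-time.
* `IsFreeField.map_evalVec` — finite-dimensional marginals of the free field are the multivariate
  Gaussians `N(0, (C_m(sᵢ, sⱼ))ᵢⱼ)`; `exists_orthonormal_reduction` — Gram–Schmidt for `C_m`.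
* `integrable_eval_mvPolynomial`, `norm_cintegral_sub_le_of_polynomial` — polynomials of a Gaussian
  vector are integrable; complex form of the Gaussian maximal-correlation inequality.

## Source and proof

Glimm–Jaffe, *Quantum Physics* (2nd ed. 1987) §6.2: Prop. 6.2.5 / (6.2.15)
`⟨θg_s, C f_t⟩ = ½⟨g, μ⁻¹e^{−μ(s+t)} f⟩`, `μ = (−Δ⃗ + m²)^{1/2} ≥ m`, and Thm. 6.2.4 / Cor. 6.2.7: the free
Hamiltonian is the second quantisation `dΓ(μ)` of `μ ≥ m`, hence `σ(H) ⊆ {0} ∪ [m, ∞)` with the Fock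
vacuum as unique ground state — equivalently, every truncated Schwinger function at reflected,
time-separated arguments decays like `e^{−mt}`. The tree has no second quantisation; we realise
Cor. 6.2.7 probabilistically, which is the same mathematics (the spectral gap of `Γ(e^{−tμ})` on the
orthocomplement of the vacuum IS Nelson's hypercontractive/maximal-correlation statement for the
Gaussian measure):

1. (§A) the one-particle estimate from the tree's momentum-space form of (6.2.15)
   (`freeCovariance_thetaTest_eq₂`, `laplaceFourier_timeShiftTest`) and Cauchy–Schwarz in the spatial
   momentum;
2. (§B) the finitely many smeared fields `ω(fᵢ)` entering `F`, `G` form a centred Gaussian vector with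
   covariance `C_m` (Mathlib: push-forward of a Gaussian measure is Gaussian; Gaussians are determined
   by mean and covariance); after a `C_m`-orthonormal reduction of the negative-time and of the
   positive-time family (null remainders vanish a.s.) its law is `N(0, [[1,K],[Kᵀ,1]])` with
   `|uᵀKv| ≤ e^{−mt}|u||v|` by step 1;
3. (§C–E) Janson's theorem `ρ(H,K) = ρ₁(H,K)` (Gaussian maximal correlation = canonical correlation;
   tree `GaussianMaximalCorrelation.abs_covariance_polynomial_le`, Janson 1997 Thm. 10.11) bounds the
   covariance of the polynomial statistics `conj P_F(θω)`, `P_G(T_t ω)` by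
   `4e^{−mt}‖P_F‖₂‖P_G‖₂`, and `‖P_F‖₂² = N(F) = Re 𝔖₂ₙ(F* ⊗ F)` (GJ (6.1.15), E1-invariance of `N`);
4. (§F) density of positive-time tensor products (OS 1973 §2; tree
   `IsPositiveTimeMulti.mem_closure_span_positiveTensorProducts_holds`) and continuity of both sides.

## References

* J. Glimm, A. Jaffe, *Quantum Physics: a functional integral point of view*, 2nd ed., Springer
  (1987), §6.1 (6.1.15), §6.2 Prop. 6.2.5, (6.2.15), Thm. 6.2.4, Cor. 6.2.7. [GlimmJaffeQP1987]
* S. Janson, *Gaussian Hilbert Spaces*, Cambridge Tracts in Math. 129 (1997), Thm. 3.50 (p. 78),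
  Thm. 10.11 (p. 177). [Janson1997]
* K. Osterwalder, R. Schrader, *Axioms for Euclidean Green's functions*, CMP 31 (1973), §2.
  [OsterwalderSchraderCMP1973]
-/

open scoped SchwartzMap ComplexConjugate FourierTransform RealInnerProductSpace Matrix ENNReal
open MeasureTheory ProbabilityTheory Complex Real Set WithLp
open Literature.MathematicalPhysics.QuantumLattice

noncomputable section

namespace Literature.MathematicalPhysics.QuantumFieldTheory

/-! ### A. The sharp one-particle bound `|C_m(θu, T_t g)| ≤ e^{-mt} C_m(u,u)^{1/2} C_m(g,g)^{1/2}` -/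

section OneParticle

variable {d : ℕ} [NeZero d]

/-- Cauchy–Schwarz for real integrals, discriminant form. [folklore] -/
private theorem abs_integral_mul_le_sqrt' {α : Type*} [MeasurableSpace α] {ν : Measure α} {X Y : α → ℝ}
    (hXY : Integrable (fun a => X a * Y a) ν) (hX : Integrable (fun a => X a ^ 2) ν)
    (hY : Integrable (fun a => Y a ^ 2) ν) :
    |∫ a, X a * Y a ∂ν| ≤ Real.sqrt (∫ a, X a ^ 2 ∂ν) * Real.sqrt (∫ a, Y a ^ 2 ∂ν) := by
  set A := ∫ a, Y a ^ 2 ∂ν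
  set B := ∫ a, X a * Y a ∂ν
  set C := ∫ a, X a ^ 2 ∂ν
  have hA : 0 ≤ A := integral_nonneg fun a => sq_nonneg _
  have hC : 0 ≤ C := integral_nonneg fun a => sq_nonneg _
  have hquad : ∀ t : ℝ, 0 ≤ A * (t * t) + (-2 * B) * t + C := by
    intro t
    have h0 : 0 ≤ ∫ a, (X a - t * Y a) ^ 2 ∂ν := integral_nonneg fun a => sq_nonneg _
    have h1 : ∫ a, (X a - t * Y a) ^ 2 ∂ν = C - 2 * t * B + t ^ 2 * A := by
      have e : ∀ a, (X a - t * Y a) ^ 2 = X a ^ 2 - 2 * t * (X a * Y a) + t ^ 2 * Y a ^ 2 := by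
        intro a; ring
      simp_rw [e]
      rw [integral_add, integral_sub hX (hXY.const_mul _), integral_const_mul, integral_const_mul]
      · exact hX.sub (hXY.const_mul _)
      · exact hY.const_mul _
    rw [h1] at h0
    nlinarith
  have hd := discrim_le_zero hquad
  rw [discrim] at hd
  have hB : B ^ 2 ≤ C * A := by nlinarith
  calc |B| = Real.sqrt (B ^ 2) := (Real.sqrt_sq_eq_abs B).symm
    _ ≤ Real.sqrt (C * A) := Real.sqrt_le_sqrt hB
    _ = Real.sqrt C * Real.sqrt A := Real.sqrt_mul hC A

omit [NeZero d] in
/-- Cauchy–Schwarz for the free covariance form: `C_m(f,g)² ≤ C_m(f,f) C_m(g,g)` (`C_m` is a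
positive semidefinite symmetric bilinear form, `m ≠ 0`). [folklore] -/
private theorem freeCovarianceReal_sq_le {m : ℝ} (hm : m ≠ 0) (f g : 𝓢(EuclideanSpace ℝ (Fin d), ℝ)) :
    freeCovarianceReal m f g ^ 2 ≤ freeCovarianceReal m f f * freeCovarianceReal m g g := by
  have hquad : ∀ s : ℝ, 0 ≤ freeCovarianceReal m g g * (s * s) + (-2 * freeCovarianceReal m f g) * s +
      freeCovarianceReal m f f := by
    intro s
    have h0 : 0 ≤ freeCovarianceReal m (f - s • g) (f - s • g) := freeCovarianceReal_self_nonneg m _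
    have h1 : freeCovarianceReal m (f - s • g) (f - s • g) =
        freeCovarianceReal m f f - 2 * s * freeCovarianceReal m f g + s * s * freeCovarianceReal m g g := by
      have e1 : freeCovarianceReal m (f - s • g) (f - s • g) =
          freeCovarianceBilin (E := EuclideanSpace ℝ (Fin d)) hm (f - s • g) (f - s • g) := rfl
      rw [e1]
      simp only [map_sub, map_smul, LinearMap.sub_apply, LinearMap.smul_apply, freeCovarianceBilin_apply,
        smul_eq_mul]
      rw [freeCovarianceReal_comm m g f]
      ring
    rw [h1] at h0
    nlinarith
  have hd := discrim_le_zero hquad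
  rw [discrim] at hd
  nlinarith

/-- `C_m(θa, a) ≤ C_m(a, a)`: Cauchy–Schwarz and reflection invariance `C_m(θa, θa) = C_m(a, a)`.
[folklore] -/
private theorem freeCovarianceReal_thetaTest_le {m : ℝ} (hm : m ≠ 0) (a : 𝓢(EuclideanSpace ℝ (Fin d), ℝ)) :
    freeCovarianceReal m (thetaTest d a) a ≤ freeCovarianceReal m a a := by
  have h1 := freeCovarianceReal_sq_le (d := d) hm (thetaTest d a) a
  rw [freeCovarianceReal_thetaTest_thetaTest, ← sq] at h1
  have h0 : 0 ≤ freeCovarianceReal m a a := freeCovarianceReal_self_nonneg m a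
  exact (abs_le_of_sq_le_sq' h1 h0).2

/-- **Sharp one-particle clustering bound for the free covariance** (Glimm–Jaffe Prop. 6.2.5,
(6.2.15) with `μ = (-Δ⃗ + m²)^{1/2} ≥ m`, Cor. 6.2.7): for `m > 0`, real `u, g` supported at
positive times and `t ≥ 0`,
`|C_m(θu, T_t g)| ≤ e^{-mt} C_m(u, u)^{1/2} C_m(g, g)^{1/2}`.
Proof: in the momentum form `C_m(θu, T_t g) = ∫ (2ω)⁻¹ conj (G_u) e^{-ωt} G_g dη`
(`freeCovariance_thetaTest_eq₂`, `laplaceFourier_timeShiftTest`), bound `e^{-ω(η)t} ≤ e^{-mt}`,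
apply Cauchy–Schwarz in `η` with the weight `(2ω)⁻¹`, identify `∫ (2ω)⁻¹ |G_u|² = C_m(θu, u)`
(the diagonal case) and use `C_m(θu, u) ≤ C_m(u, u)`.
[cite: GlimmJaffeQP1987, Prop. 6.2.5 (6.2.15) and Cor. 6.2.7] -/
theorem abs_freeCovarianceReal_thetaTest_timeShiftTest_le {m : ℝ} (hm : 0 < m)
    {u g : 𝓢(EuclideanSpace ℝ (Fin d), ℝ)} (hu : IsPositiveTime u) (hg : IsPositiveTime g)
    {t : ℝ} (ht : 0 ≤ t) :
    |freeCovarianceReal m (thetaTest d u) (timeShiftTest d t g)| ≤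
      Real.exp (-(m * t)) * Real.sqrt (freeCovarianceReal m u u) * Real.sqrt (freeCovarianceReal m g g) := by
  obtain ⟨n, rfl⟩ : ∃ n, d = n + 1 := Nat.exists_eq_add_one_of_ne_zero (NeZero.ne d)
  have hU : IsPositiveTime (ofRealTest u) := hu.ofRealTest
  have hV : IsPositiveTime (ofRealTest g) := hg.ofRealTest
  have hVt : IsPositiveTime (timeShiftTest (n + 1) t (ofRealTest g)) :=
    IsPositiveTime.timeShiftTest_holds hV ht
  -- abbreviations
  set Ω : (Fin n → ℝ) → ℝ := fun η => √((2 * π) ^ 2 * ∑ j, η j ^ 2 + m ^ 2) with hΩ_def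
  set GU : (Fin n → ℝ) → ℂ := fun η => ∫ y : EuclideanSpace ℝ (Fin (n + 1)),
    (𝐞 (-∑ j, y j.succ * η j) : ℂ) * (rexp (-(Ω η * |y 0|)) : ℂ) * ofRealTest u y with hGU_def
  set GV : (Fin n → ℝ) → ℂ := fun η => ∫ x : EuclideanSpace ℝ (Fin (n + 1)),
    (𝐞 (-∑ j, x j.succ * η j) : ℂ) * (rexp (-(Ω η * |x 0|)) : ℂ) * ofRealTest g x with hGV_def
  set X : (Fin n → ℝ) → ℝ := fun η => Real.sqrt ((2 * Ω η)⁻¹) * ‖GU η‖ with hX_def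
  set Y : (Fin n → ℝ) → ℝ := fun η => Real.sqrt ((2 * Ω η)⁻¹) * ‖GV η‖ with hY_def
  have hΩ0 : ∀ η, 0 ≤ (2 * Ω η)⁻¹ := fun η => by positivity
  have hXY : ∀ η, X η * Y η = (2 * Ω η)⁻¹ * (‖GU η‖ * ‖GV η‖) := by
    intro η
    have := Real.mul_self_sqrt (hΩ0 η)
    simp only [hX_def, hY_def]
    calc Real.sqrt ((2 * Ω η)⁻¹) * ‖GU η‖ * (Real.sqrt ((2 * Ω η)⁻¹) * ‖GV η‖)
        = Real.sqrt ((2 * Ω η)⁻¹) * Real.sqrt ((2 * Ω η)⁻¹) * (‖GU η‖ * ‖GV η‖) := by ring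
      _ = _ := by rw [this]
  have hXX : ∀ η, X η ^ 2 = (2 * Ω η)⁻¹ * (‖GU η‖ * ‖GU η‖) := by
    intro η
    have := Real.mul_self_sqrt (hΩ0 η)
    simp only [hX_def]
    calc (Real.sqrt ((2 * Ω η)⁻¹) * ‖GU η‖) ^ 2
        = Real.sqrt ((2 * Ω η)⁻¹) * Real.sqrt ((2 * Ω η)⁻¹) * (‖GU η‖ * ‖GU η‖) := by ring
      _ = _ := by rw [this]
  have hYY : ∀ η, Y η ^ 2 = (2 * Ω η)⁻¹ * (‖GV η‖ * ‖GV η‖) := by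
    intro η
    have := Real.mul_self_sqrt (hΩ0 η)
    simp only [hY_def]
    calc (Real.sqrt ((2 * Ω η)⁻¹) * ‖GV η‖) ^ 2
        = Real.sqrt ((2 * Ω η)⁻¹) * Real.sqrt ((2 * Ω η)⁻¹) * (‖GV η‖ * ‖GV η‖) := by ring
      _ = _ := by rw [this]
  -- integrability of `X Y`, `X²`, `Y²` (norms of the integrable `dη`-integrands)
  have hnorm : ∀ {a b : 𝓢(EuclideanSpace ℝ (Fin (n + 1)), ℝ)} (ha : IsPositiveTime (ofRealTest a))
      (hb : IsPositiveTime (ofRealTest b)),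
      Integrable (fun η : Fin n → ℝ => (2 * Ω η)⁻¹ *
        (‖∫ y : EuclideanSpace ℝ (Fin (n + 1)), (𝐞 (-∑ j, y j.succ * η j) : ℂ) *
            (rexp (-(Ω η * |y 0|)) : ℂ) * ofRealTest a y‖ *
         ‖∫ x : EuclideanSpace ℝ (Fin (n + 1)), (𝐞 (-∑ j, x j.succ * η j) : ℂ) *
            (rexp (-(Ω η * |x 0|)) : ℂ) * ofRealTest b x‖)) := by
    intro a b ha hb
    refine (integrable_laplaceFourier_mul hm.ne' ha hb).norm.congr (ae_of_all _ fun η => ?_)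
    have hΩ0' : 0 ≤ (2 * √((2 * π) ^ 2 * ∑ j, η j ^ 2 + m ^ 2))⁻¹ := by positivity
    simp only [norm_mul, RCLike.norm_conj, Complex.norm_of_nonneg hΩ0', hΩ_def]
  have hIXY : Integrable (fun η => X η * Y η) := by
    simp_rw [hXY]; exact hnorm hU hV
  have hIXX : Integrable (fun η => X η ^ 2) := by
    simp_rw [hXX]; exact hnorm hU hU
  have hIYY : Integrable (fun η => Y η ^ 2) := by
    simp_rw [hYY]; exact hnorm hV hV
  -- the diagonal identification `∫ X² = C_m(θu, u)`, `∫ Y² = C_m(θg, g)`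
  have hdiag : ∀ {a : 𝓢(EuclideanSpace ℝ (Fin (n + 1)), ℝ)} (ha : IsPositiveTime (ofRealTest a)),
      ∫ η : Fin n → ℝ, (2 * Ω η)⁻¹ *
        (‖∫ y : EuclideanSpace ℝ (Fin (n + 1)), (𝐞 (-∑ j, y j.succ * η j) : ℂ) *
            (rexp (-(Ω η * |y 0|)) : ℂ) * ofRealTest a y‖ *
         ‖∫ y : EuclideanSpace ℝ (Fin (n + 1)), (𝐞 (-∑ j, y j.succ * η j) : ℂ) *
            (rexp (-(Ω η * |y 0|)) : ℂ) * ofRealTest a y‖) =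
        freeCovarianceReal m (thetaTest (n + 1) a) a := by
    intro a ha
    have hre := integral_re (integrable_laplaceFourier_mul hm.ne' ha ha)
    simp only [RCLike.re_to_complex] at hre
    rw [freeCovarianceReal, ofRealTest_thetaTest, freeCovariance_thetaTest_eq₂ hm.ne' ha ha, ← hre]
    refine integral_congr_ae (ae_of_all _ fun η => ?_)
    beta_reduce
    rw [Complex.conj_mul', ← Complex.ofReal_pow, ← Complex.ofReal_mul, Complex.ofReal_re]
    simp only [hΩ_def, sq]
  have hXX' : ∫ η, X η ^ 2 = freeCovarianceReal m (thetaTest (n + 1) u) u := by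
    simp_rw [hXX]; exact hdiag hU
  have hYY' : ∫ η, Y η ^ 2 = freeCovarianceReal m (thetaTest (n + 1) g) g := by
    simp_rw [hYY]; exact hdiag hV
  -- the two-point function in momentum form
  rw [freeCovarianceReal, ofRealTest_thetaTest, ofRealTest_timeShiftTest,
    freeCovariance_thetaTest_eq₂ hm.ne' hU hVt]
  simp_rw [laplaceFourier_timeShiftTest hV _ _ ht]
  -- pointwise bound of the integrand
  have hbound : ∀ η : Fin n → ℝ,
      ‖(((2 * Ω η)⁻¹ : ℝ) : ℂ) * (conj (GU η) * ((rexp (-(Ω η * t)) : ℂ) * GV η))‖ ≤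
        rexp (-(m * t)) * (X η * Y η) := by
    intro η
    have hexp : rexp (-(Ω η * t)) ≤ rexp (-(m * t)) := by
      refine Real.exp_le_exp.2 (neg_le_neg ?_)
      exact mul_le_mul_of_nonneg_right (le_sqrt_dispersion hm.le η) ht
    rw [hXY, norm_mul, norm_mul, norm_mul, RCLike.norm_conj, Complex.norm_of_nonneg (hΩ0 η),
      Complex.norm_of_nonneg (Real.exp_pos _).le]
    calc (2 * Ω η)⁻¹ * (‖GU η‖ * (rexp (-(Ω η * t)) * ‖GV η‖))
        = rexp (-(Ω η * t)) * ((2 * Ω η)⁻¹ * (‖GU η‖ * ‖GV η‖)) := by ring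
      _ ≤ rexp (-(m * t)) * ((2 * Ω η)⁻¹ * (‖GU η‖ * ‖GV η‖)) :=
          mul_le_mul_of_nonneg_right hexp (mul_nonneg (hΩ0 η) (mul_nonneg (norm_nonneg _)
            (norm_nonneg _)))
  have hCS := abs_integral_mul_le_sqrt' hIXY hIXX hIYY
  rw [hXX', hYY'] at hCS
  have hXYnn : 0 ≤ ∫ η, X η * Y η :=
    integral_nonneg fun η => by rw [hXY]; exact mul_nonneg (hΩ0 η) (mul_nonneg (norm_nonneg _) (norm_nonneg _))
  rw [abs_of_nonneg hXYnn] at hCS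
  calc |(∫ η : Fin n → ℝ, (((2 * Ω η)⁻¹ : ℝ) : ℂ) *
          (conj (GU η) * ((rexp (-(Ω η * t)) : ℂ) * GV η))).re|
      ≤ ‖∫ η : Fin n → ℝ, (((2 * Ω η)⁻¹ : ℝ) : ℂ) *
          (conj (GU η) * ((rexp (-(Ω η * t)) : ℂ) * GV η))‖ := abs_re_le_norm _
    _ ≤ ∫ η : Fin n → ℝ, rexp (-(m * t)) * (X η * Y η) :=
        norm_integral_le_of_norm_le (hIXY.const_mul _) (ae_of_all _ hbound)
    _ = rexp (-(m * t)) * ∫ η, X η * Y η := integral_const_mul _ _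
    _ ≤ rexp (-(m * t)) * (Real.sqrt (freeCovarianceReal m (thetaTest (n + 1) u) u) *
          Real.sqrt (freeCovarianceReal m (thetaTest (n + 1) g) g)) :=
        mul_le_mul_of_nonneg_left hCS (Real.exp_pos _).le
    _ ≤ rexp (-(m * t)) * (Real.sqrt (freeCovarianceReal m u u) * Real.sqrt (freeCovarianceReal m g g)) := by
        gcongr
        · exact freeCovarianceReal_thetaTest_le hm.ne' u
        · exact freeCovarianceReal_thetaTest_le hm.ne' g
    _ = _ := by ring

/-- The one-particle bound with a negative-time first argument: for real `f` with `θf`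
positive-time, `g` positive-time and `t ≥ 0`,
`|C_m(f, T_t g)| ≤ e^{-mt} C_m(f, f)^{1/2} C_m(g, g)^{1/2}` (`f = θu`, `C_m(θu, θu) = C_m(u, u)`).
[cite: GlimmJaffeQP1987, Prop. 6.2.5 (6.2.15) and Cor. 6.2.7] -/
theorem abs_freeCovarianceReal_timeShiftTest_le_exp {m : ℝ} (hm : 0 < m)
    {f g : 𝓢(EuclideanSpace ℝ (Fin d), ℝ)} (hf : IsPositiveTime (thetaTest d f)) (hg : IsPositiveTime g)
    {t : ℝ} (ht : 0 ≤ t) :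
    |freeCovarianceReal m f (timeShiftTest d t g)| ≤
      Real.exp (-(m * t)) * Real.sqrt (freeCovarianceReal m f f) * Real.sqrt (freeCovarianceReal m g g) := by
  have h := abs_freeCovarianceReal_thetaTest_timeShiftTest_le (d := d) hm hf hg ht
  rwa [thetaTest_involutive d f, freeCovarianceReal_thetaTest_thetaTest] at h

end OneParticle


/-! ### B. Finite-dimensional marginals of the free field and orthonormal reduction -/

section EvalVec

variable {E : Type*} [NormedAddCommGroup E] [NormedSpace ℝ E] {σ : Type*}

/-- The vector of evaluations `ω ↦ (ω(s_i))_i ∈ ℝ^σ` of a field configuration at finitely many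
test functions, as a continuous linear map on `𝒮'`. [folklore] -/
def evalVec (s : σ → 𝓢(E, ℝ)) : FieldConfig E →L[ℝ] EuclideanSpace ℝ σ :=
  (EuclideanSpace.equiv σ ℝ).symm.toContinuousLinearMap ∘L
    ContinuousLinearMap.pi fun i => PointwiseConvergenceCLM.evalCLM (RingHom.id ℝ) ℝ (s i)

/-- Coordinates of `evalVec`. [folklore] -/
@[simp] private theorem evalVec_apply (s : σ → 𝓢(E, ℝ)) (ω : FieldConfig E) (i : σ) :
    evalVec s ω i = ω (s i) := rfl

/-- `evalVec s ω = ∑ᵢ ω(sᵢ) eᵢ`. [folklore] -/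
private theorem evalVec_eq_sum [Fintype σ] [DecidableEq σ] (s : σ → 𝓢(E, ℝ)) (ω : FieldConfig E) :
    evalVec s ω = ∑ i, (ω (s i)) • EuclideanSpace.single i (1 : ℝ) := by
  ext j
  simp only [evalVec_apply, WithLp.ofLp_sum, WithLp.ofLp_smul, Finset.sum_apply, Pi.smul_apply,
    PiLp.ofLp_single, Pi.single_apply, smul_eq_mul, mul_ite, mul_one, mul_zero]
  rw [Finset.sum_ite_eq]
  simp

end EvalVec

section GaussianVector

variable {E : Type*} [NormedAddCommGroup E] [InnerProductSpace ℝ E] [FiniteDimensional ℝ E]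
  [MeasurableSpace E] [BorelSpace E]
variable {σ : Type*} [Fintype σ]

/-- The Gram matrix `(C_m(s_i, s_j))_{ij}` of finitely many test functions. [folklore] -/
def freeCovGram (m : ℝ) (s : σ → 𝓢(E, ℝ)) : Matrix σ σ ℝ :=
  Matrix.of fun i j => freeCovarianceReal m (s i) (s j)

omit [Fintype σ] in
/-- Entries of the Gram matrix. [folklore] -/
@[simp] private theorem freeCovGram_apply (m : ℝ) (s : σ → 𝓢(E, ℝ)) (i j : σ) :
    freeCovGram m s i j = freeCovarianceReal m (s i) (s j) := rfl

/-- The Gram quadratic form is `C_m(∑ xᵢ sᵢ, ∑ xᵢ sᵢ)`. [folklore] -/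
private theorem dotProduct_covGram_mulVec {m : ℝ} (hm : m ≠ 0) (s : σ → 𝓢(E, ℝ)) (x y : σ → ℝ) :
    x ⬝ᵥ (freeCovGram m s *ᵥ y) = freeCovarianceReal m (∑ i, x i • s i) (∑ j, y j • s j) := by
  have : freeCovarianceReal m (∑ i, x i • s i) (∑ j, y j • s j) =
      freeCovarianceBilin (E := E) hm (∑ i, x i • s i) (∑ j, y j • s j) := rfl
  rw [this]
  simp only [dotProduct, Matrix.mulVec, freeCovGram, Matrix.of_apply, map_sum, map_smul, LinearMap.sum_apply,
    LinearMap.smul_apply, smul_eq_mul, Finset.mul_sum, freeCovarianceBilin_apply]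
  rw [Finset.sum_comm]
  refine Finset.sum_congr rfl fun i _ => Finset.sum_congr rfl fun j _ => ?_
  ring

/-- The cross Gram matrix `(C_m(s_i, s'_j))_{ij}` of two finite families. [folklore] -/
def freeCovGram₂ {τ : Type*} (m : ℝ) (s : σ → 𝓢(E, ℝ)) (s' : τ → 𝓢(E, ℝ)) : Matrix σ τ ℝ :=
  Matrix.of fun i j => freeCovarianceReal m (s i) (s' j)

/-- The cross Gram bilinear form is `C_m(∑ xᵢ sᵢ, ∑ yⱼ s'ⱼ)`. [folklore] -/
private theorem dotProduct_freeCovGram₂_mulVec {τ : Type*} [Fintype τ] {m : ℝ} (hm : m ≠ 0) (s : σ → 𝓢(E, ℝ))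
    (s' : τ → 𝓢(E, ℝ)) (x : σ → ℝ) (y : τ → ℝ) :
    x ⬝ᵥ (freeCovGram₂ m s s' *ᵥ y) = freeCovarianceReal m (∑ i, x i • s i) (∑ j, y j • s' j) := by
  have : freeCovarianceReal m (∑ i, x i • s i) (∑ j, y j • s' j) =
      freeCovarianceBilin (E := E) hm (∑ i, x i • s i) (∑ j, y j • s' j) := rfl
  rw [this]
  simp only [dotProduct, Matrix.mulVec, freeCovGram₂, Matrix.of_apply, map_sum, map_smul, LinearMap.sum_apply,
    LinearMap.smul_apply, smul_eq_mul, Finset.mul_sum, freeCovarianceBilin_apply]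
  rw [Finset.sum_comm]
  refine Finset.sum_congr rfl fun i _ => Finset.sum_congr rfl fun j _ => ?_
  ring

/-- The Gram matrix of `C_m` is positive semidefinite (Glimm–Jaffe §6.2 (6.2.1), (6.2.4)). [cite: GlimmJaffeQP1987, §6.2 (6.2.4)] -/
theorem posSemidef_covGram {m : ℝ} (hm : m ≠ 0) (s : σ → 𝓢(E, ℝ)) : (freeCovGram m s).PosSemidef := by
  refine Matrix.PosSemidef.of_dotProduct_mulVec_nonneg (Matrix.IsHermitian.ext fun i j => ?_) fun x => ?_
  · simp only [freeCovGram_apply, star_trivial]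
    exact freeCovarianceReal_comm m _ _
  · rw [star_trivial, dotProduct_covGram_mulVec hm]
    exact freeCovarianceReal_self_nonneg m _

variable {m : ℝ} {μ : Measure (FieldConfig E)} [DecidableEq σ]

/-- **Finite-dimensional marginals of the free field are multivariate Gaussians**: under the free
field of mass `m ≠ 0`, the evaluation vector `(ω(s_i))_i` has law `N(0, (C_m(s_i, s_j))_{ij})`
(Glimm–Jaffe §6.2, (6.2.4): the generating functional `exp(−½⟨f, Cf⟩)` restricted to
`f = ∑ λᵢ sᵢ`; here via Mathlib: the push-forward of a Gaussian measure under a continuous linear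
map is Gaussian, and Gaussians are determined by mean and covariance). [cite: GlimmJaffeQP1987, §6.2 (6.2.4)] -/
theorem _root_.Literature.MathematicalPhysics.QuantumLattice.IsFreeField.map_evalVec (hm : m ≠ 0)
    (h : IsFreeField m μ) (s : σ → 𝓢(E, ℝ)) :
    μ.map (evalVec s) = multivariateGaussian 0 (freeCovGram m s) := by
  haveI : IsGaussian μ := h.1.1
  haveI : IsGaussian (μ.map (evalVec s)) :=
    isGaussian_map_of_measurable (evalVec s).continuous.measurable
  have hS : (freeCovGram m s).PosSemidef := posSemidef_covGram hm s
  have hmom : HasAllMoments μ := fun p f => h.1.memLp_eval f p ENNReal.coe_ne_top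
  apply IsGaussian.ext
  · rw [integral_id_multivariateGaussian', integral_map (evalVec s).continuous.measurable.aemeasurable
      aestronglyMeasurable_id]
    change ∫ ω, evalVec s ω ∂μ = 0
    simp_rw [evalVec_eq_sum]
    rw [integral_finsetSum _ fun i _ => ((h.1.2 (s i)).1.smul_const _)]
    simp [integral_smul_const, (h.1.2 (s _)).2]
  · rw [← ContinuousLinearMap.toBilinForm_inj]
    refine LinearMap.BilinForm.ext_basis (EuclideanSpace.basisFun σ ℝ).toBasis fun i j => ?_
    rw [ContinuousLinearMap.toBilinForm_apply, ContinuousLinearMap.toBilinForm_apply,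
      covarianceBilin_multivariateGaussian hS, covarianceBilin_apply_eq_cov IsGaussian.memLp_two_id,
      covariance_map]
    · have hb : ∀ i : σ, (fun u : EuclideanSpace ℝ σ => ⟪(EuclideanSpace.basisFun σ ℝ).toBasis i, u⟫) ∘
          evalVec s = fun ω : FieldConfig E => ω (s i) := by
        intro i; ext ω; simp [PiLp.inner_apply]
      rw [hb, hb, covariance_eq_sub (hmom 2 (s i)) (hmom 2 (s j))]
      have h0 : ∀ i : σ, ∫ ω, ω (s i) ∂μ = 0 := fun i => (h.1.2 (s i)).2
      simp only [Pi.mul_apply, h0, mul_zero, sub_zero]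
      rw [h.integral_eval_mul_eval hm hmom]
      simp [Matrix.mulVec, dotProduct, freeCovGram]
    · exact Measurable.aestronglyMeasurable (by fun_prop)
    · exact Measurable.aestronglyMeasurable (by fun_prop)
    · exact (evalVec s).continuous.measurable.aemeasurable

/-- Integration against the marginal: `∫ Φ((ω(s_i))_i) dμ = ∫ Φ dN(0, freeCovGram)` (Glimm–Jaffe §6.2
(6.2.4)). [cite: GlimmJaffeQP1987, §6.2 (6.2.4)] -/
theorem _root_.Literature.MathematicalPhysics.QuantumLattice.IsFreeField.integral_comp_evalVec (hm : m ≠ 0)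
    (h : IsFreeField m μ) (s : σ → 𝓢(E, ℝ)) {Φ : EuclideanSpace ℝ σ → ℝ} (hΦ : Measurable Φ) :
    ∫ ω, Φ (evalVec s ω) ∂μ = ∫ z, Φ z ∂(multivariateGaussian 0 (freeCovGram m s)) := by
  rw [← h.map_evalVec hm s, integral_map (evalVec s).continuous.measurable.aemeasurable
    hΦ.aestronglyMeasurable]

end GaussianVector

/-! ### B'. Orthonormal reduction of a finite family for the form `C_m` -/

section Orthonormal

variable {E : Type*} [NormedAddCommGroup E] [InnerProductSpace ℝ E] [FiniteDimensional ℝ E]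
  [MeasurableSpace E] [BorelSpace E]

/-- **Orthonormal reduction.** For `m ≠ 0` and a finite family `φ` of real test functions there
is a finite `C_m`-orthonormal family `e` in the span of `φ` and coefficients `c` such that every
`φ_i − ∑_a c_{ia} e_a` is `C_m`-null (Gram–Schmidt for the positive semidefinite symmetric form
`C_m`: diagonalise on the span, normalise the non-null basis vectors, the null ones span the
radical). [folklore] -/
private theorem exists_orthonormal_reduction {m : ℝ} (hm : m ≠ 0) {I : Type*} [Finite I] (φ : I → 𝓢(E, ℝ)) :
    ∃ (r : ℕ) (e : Fin r → 𝓢(E, ℝ)) (c : I → Fin r → ℝ),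
      (∀ a b, freeCovarianceReal m (e a) (e b) = if a = b then 1 else 0) ∧
      (∀ a, e a ∈ Submodule.span ℝ (Set.range φ)) ∧
      ∀ i, freeCovarianceReal m (φ i - ∑ a, c i a • e a) (φ i - ∑ a, c i a • e a) = 0 := by
  classical
  -- the span `W` of the family and the restricted form
  haveI : FiniteDimensional ℝ (Submodule.span ℝ (Set.range φ)) :=
    FiniteDimensional.span_of_finite ℝ (Set.finite_range φ)
  have hBapp : ∀ x y : Submodule.span ℝ (Set.range φ),
      (freeCovarianceBilin (E := E) hm).restrict (Submodule.span ℝ (Set.range φ)) x y =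
        freeCovarianceReal m (x : 𝓢(E, ℝ)) (y : 𝓢(E, ℝ)) := fun x y => rfl
  have hBsymm : ((freeCovarianceBilin (E := E) hm).restrict (Submodule.span ℝ (Set.range φ))).IsSymm :=
    ⟨fun x y => by rw [hBapp, hBapp, freeCovarianceReal_comm]⟩
  haveI : Invertible (2 : ℝ) := invertibleOfNonzero two_ne_zero
  obtain ⟨v, hv⟩ := LinearMap.BilinForm.exists_orthogonal_basis (LinearMap.BilinForm.isSymm_iff.1 hBsymm)
  -- the diagonal entries `λ_k = C_m(v_k, v_k) ≥ 0`, off-diagonal entries vanish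
  obtain ⟨lam, hlam⟩ : ∃ lam : Fin (Module.finrank ℝ (Submodule.span ℝ (Set.range φ))) → ℝ,
      ∀ k, lam k = freeCovarianceReal m (v k : 𝓢(E, ℝ)) (v k : 𝓢(E, ℝ)) := ⟨_, fun k => rfl⟩
  have hlam0 : ∀ k, 0 ≤ lam k := fun k => by rw [hlam]; exact freeCovarianceReal_self_nonneg m _
  have hvoff : ∀ k l, k ≠ l → freeCovarianceReal m (v k : 𝓢(E, ℝ)) (v l : 𝓢(E, ℝ)) = 0 :=
    fun k l hkl => by rw [← hBapp]; exact hv hkl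
  -- the non-null indices `P`, enumerated by `Fin r`
  obtain ⟨P, hP⟩ : ∃ P : Finset (Fin (Module.finrank ℝ (Submodule.span ℝ (Set.range φ)))),
      ∀ k, k ∈ P ↔ lam k ≠ 0 := ⟨Finset.univ.filter fun k => lam k ≠ 0, fun k => by simp⟩
  obtain ⟨r, ⟨ε⟩⟩ : ∃ r : ℕ, Nonempty (P ≃ Fin r) := ⟨P.card, ⟨P.equivFin⟩⟩
  obtain ⟨idx, hidx⟩ : ∃ idx : Fin r → Fin (Module.finrank ℝ (Submodule.span ℝ (Set.range φ))),
      ∀ a, idx a = (ε.symm a : P) := ⟨_, fun a => rfl⟩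
  have hidxP : ∀ a, lam (idx a) ≠ 0 := fun a => (hP _).1 (by rw [hidx]; exact (ε.symm a).2)
  have hidx_inj : Function.Injective idx := fun a b hab => by
    rw [hidx, hidx] at hab
    exact ε.symm.injective (Subtype.ext hab)
  have hidx_sum : ∀ f : Fin (Module.finrank ℝ (Submodule.span ℝ (Set.range φ))) → 𝓢(E, ℝ),
      ∑ a, f (idx a) = ∑ k ∈ P, f k := by
    intro f
    rw [← Finset.sum_coe_sort P]
    exact Fintype.sum_equiv ε.symm (fun a => f (idx a)) (fun k : P => f k) fun a => by rw [hidx]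
  have hlampos : ∀ a, 0 < lam (idx a) := fun a => lt_of_le_of_ne (hlam0 _) (Ne.symm (hidxP a))
  have hsq : ∀ a, Real.sqrt (lam (idx a)) ≠ 0 := fun a => (Real.sqrt_pos.2 (hlampos a)).ne'
  -- the orthonormal family and the coefficients
  obtain ⟨e, he⟩ : ∃ e : Fin r → 𝓢(E, ℝ), ∀ a, e a = (Real.sqrt (lam (idx a)))⁻¹ • (v (idx a) : 𝓢(E, ℝ)) :=
    ⟨_, fun a => rfl⟩
  obtain ⟨c, hc⟩ : ∃ c : I → Fin r → ℝ, ∀ i a,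
      c i a = v.repr ⟨φ i, Submodule.subset_span ⟨i, rfl⟩⟩ (idx a) * Real.sqrt (lam (idx a)) :=
    ⟨_, fun i a => rfl⟩
  -- bilinear computations through `freeCovarianceBilin`
  have hsmul : ∀ (a b : ℝ) (x y : 𝓢(E, ℝ)),
      freeCovarianceReal m (a • x) (b • y) = a * b * freeCovarianceReal m x y := by
    intro a b x y
    rw [show freeCovarianceReal m (a • x) (b • y) = freeCovarianceBilin (E := E) hm (a • x) (b • y) from rfl,
      map_smul, map_smul, LinearMap.smul_apply, smul_eq_mul, smul_eq_mul, freeCovarianceBilin_apply]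
    ring
  have hsumsum : ∀ (S : Finset (Fin (Module.finrank ℝ (Submodule.span ℝ (Set.range φ)))))
      (x : Fin (Module.finrank ℝ (Submodule.span ℝ (Set.range φ))) → ℝ),
      freeCovarianceReal m (∑ k ∈ S, x k • (v k : 𝓢(E, ℝ))) (∑ k ∈ S, x k • (v k : 𝓢(E, ℝ))) =
        ∑ k ∈ S, x k * x k * lam k := by
    intro S x
    rw [show freeCovarianceReal m (∑ k ∈ S, x k • (v k : 𝓢(E, ℝ))) (∑ k ∈ S, x k • (v k : 𝓢(E, ℝ))) =
        freeCovarianceBilin (E := E) hm (∑ k ∈ S, x k • (v k : 𝓢(E, ℝ)))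
          (∑ k ∈ S, x k • (v k : 𝓢(E, ℝ))) from rfl]
    simp only [map_sum, map_smul, LinearMap.sum_apply, LinearMap.smul_apply, smul_eq_mul,
      freeCovarianceBilin_apply]
    refine Finset.sum_congr rfl fun k hk => ?_
    rw [Finset.mul_sum, ← Finset.add_sum_erase S _ hk, hlam]
    rw [Finset.sum_eq_zero fun l hl => ?_]
    · ring
    · rw [hvoff l k (Finset.ne_of_mem_erase hl), mul_zero, mul_zero]
  refine ⟨r, e, c, fun a b => ?_, fun a => ?_, fun i => ?_⟩
  · -- orthonormality
    rw [he, he, hsmul]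
    by_cases hab : a = b
    · subst hab
      rw [if_pos rfl, ← hlam]
      have hq : Real.sqrt (lam (idx a)) * Real.sqrt (lam (idx a)) = lam (idx a) :=
        Real.mul_self_sqrt (hlam0 (idx a))
      rw [show (Real.sqrt (lam (idx a)))⁻¹ * (Real.sqrt (lam (idx a)))⁻¹ * lam (idx a) =
          (Real.sqrt (lam (idx a)))⁻¹ * (Real.sqrt (lam (idx a)))⁻¹ *
            (Real.sqrt (lam (idx a)) * Real.sqrt (lam (idx a))) by rw [hq]]
      field_simp [hsq a]
    · rw [if_neg hab, hvoff _ _ (fun h => hab (hidx_inj h)), mul_zero]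
  · -- `e a ∈ W`
    rw [he]
    exact (Submodule.span ℝ (Set.range φ)).smul_mem _ (v (idx a)).2
  · -- the remainder is `C_m`-null
    set w : Submodule.span ℝ (Set.range φ) := ⟨φ i, Submodule.subset_span ⟨i, rfl⟩⟩ with hw
    have hsum : ∑ a, c i a • e a = ∑ k ∈ P, v.repr w k • (v k : 𝓢(E, ℝ)) := by
      have h1 : ∀ a, c i a • e a = v.repr w (idx a) • (v (idx a) : 𝓢(E, ℝ)) := by
        intro a
        rw [hc, he, smul_smul, mul_assoc, mul_inv_cancel₀ (hsq a), mul_one]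
      simp_rw [h1]
      exact hidx_sum fun k => v.repr w k • (v k : 𝓢(E, ℝ))
    have htot : (φ i : 𝓢(E, ℝ)) = ∑ k, v.repr w k • (v k : 𝓢(E, ℝ)) := by
      have h2 : ((∑ k, v.repr w k • v k : Submodule.span ℝ (Set.range φ)) : 𝓢(E, ℝ)) =
          ∑ k, v.repr w k • (v k : 𝓢(E, ℝ)) := by
        rw [Submodule.coe_sum]; rfl
      rw [← h2, v.sum_repr w]
    have hrem : φ i - ∑ a, c i a • e a = ∑ k ∈ Pᶜ, v.repr w k • (v k : 𝓢(E, ℝ)) := by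
      rw [hsum, htot, ← Finset.sum_add_sum_compl P, add_sub_cancel_left]
    rw [hrem, hsumsum]
    refine Finset.sum_eq_zero fun k hk => ?_
    have : lam k = 0 := by
      by_contra hne
      exact (Finset.mem_compl.1 hk) ((hP k).2 hne)
    rw [this, mul_zero]

end Orthonormal



/-! ### C. Polynomial functions of Gaussian vectors: integrability and the complex form of the
maximal-correlation inequality -/

section PolyIntegrable

variable {σ : Type*} [Fintype σ]

/-- `(1 + a)^N ≤ 2^N (1 + a^N)` for `a ≥ 0`. [folklore] -/
private theorem one_add_pow_le' (a : ℝ) (ha : 0 ≤ a) (N : ℕ) : (1 + a) ^ N ≤ 2 ^ N * (1 + a ^ N) := by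
  rcases le_total a 1 with h | h
  · calc (1 + a) ^ N ≤ (2 : ℝ) ^ N := pow_le_pow_left₀ (by positivity) (by linarith) N
      _ ≤ 2 ^ N * (1 + a ^ N) := le_mul_of_one_le_right (by positivity) (by
          have := pow_nonneg ha N; linarith)
  · calc (1 + a) ^ N ≤ (2 * a) ^ N := pow_le_pow_left₀ (by positivity) (by linarith) N
      _ = 2 ^ N * a ^ N := mul_pow 2 a N
      _ ≤ 2 ^ N * (1 + a ^ N) := mul_le_mul_of_nonneg_left (by linarith) (by positivity)

/-- Polynomial growth of polynomial functions on `ℝ^σ`: `|Q(z)| ≤ (∑ |coeff|) (1 + ‖z‖)^{deg Q}`.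
[folklore] -/
private theorem abs_eval_le_pow (Q : MvPolynomial σ ℝ) (z : EuclideanSpace ℝ σ) :
    |MvPolynomial.eval (ofLp z) Q| ≤ (∑ d ∈ Q.support, |Q.coeff d|) * (1 + ‖z‖) ^ Q.totalDegree := by
  rw [MvPolynomial.eval_eq, Finset.sum_mul]
  refine (Finset.abs_sum_le_sum_abs _ _).trans (Finset.sum_le_sum fun d hd => ?_)
  rw [abs_mul]
  refine mul_le_mul_of_nonneg_left ?_ (abs_nonneg _)
  rw [Finset.abs_prod]
  have h1 : 1 ≤ 1 + ‖z‖ := by linarith [norm_nonneg z]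
  calc ∏ i ∈ d.support, |(ofLp z) i ^ d i| ≤ ∏ i ∈ d.support, (1 + ‖z‖) ^ d i := by
        refine Finset.prod_le_prod (fun i _ => abs_nonneg _) fun i _ => ?_
        rw [abs_pow]
        refine pow_le_pow_left₀ (abs_nonneg _) ?_ _
        have : |ofLp z i| ≤ ‖z‖ := by
          have := PiLp.norm_apply_le z i
          rwa [Real.norm_eq_abs] at this
        linarith
    _ = (1 + ‖z‖) ^ (∑ i ∈ d.support, d i) := Finset.prod_pow_eq_pow_sum _ _ _
    _ ≤ (1 + ‖z‖) ^ Q.totalDegree := pow_le_pow_right₀ h1 (MvPolynomial.le_totalDegree hd)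

/-- **Polynomials are integrable for Gaussian measures on `ℝ^σ`** (all moments are finite,
Fernique / Janson 1997 Ch. 3). [cite: Janson1997, Theorem 3.50] -/
theorem integrable_eval_mvPolynomial (γ : Measure (EuclideanSpace ℝ σ)) [IsGaussian γ]
    (Q : MvPolynomial σ ℝ) : Integrable (fun z => MvPolynomial.eval (ofLp z) Q) γ := by
  set N := Q.totalDegree
  set C := ∑ d ∈ Q.support, |Q.coeff d|
  have hC : 0 ≤ C := Finset.sum_nonneg fun _ _ => abs_nonneg _
  have hpow : Integrable (fun z : EuclideanSpace ℝ σ => ‖z‖ ^ N) γ := by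
    simpa using (IsGaussian.memLp_id γ N (ENNReal.natCast_ne_top N)).integrable_norm_pow'
  have hdom : Integrable (fun z : EuclideanSpace ℝ σ => C * (2 ^ N * (1 + ‖z‖ ^ N))) γ :=
    (((integrable_const 1).add hpow).const_mul _).const_mul _
  refine hdom.mono' ((MvPolynomial.continuous_eval Q).comp (PiLp.continuous_ofLp 2 _)).aestronglyMeasurable
    (ae_of_all _ fun z => ?_)
  rw [Real.norm_eq_abs]
  exact (abs_eval_le_pow Q z).trans (mul_le_mul_of_nonneg_left (one_add_pow_le' ‖z‖ (norm_nonneg z) N) hC)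

end PolyIntegrable

section ComplexCorrelation

open Literature.Probability.Distributions.GaussianHermite (xL xR γm SK abs_covariance_polynomial_le)

variable {ι κ : Type*} [Fintype ι] [Fintype κ] [DecidableEq ι] [DecidableEq κ]

/-- `‖Cov‖` of complex polynomial statistics with real and imaginary parts `(a₁, a₂)`, `(b₁, b₂)`:
the complex covariance splits into four real covariances. [folklore] -/
private theorem cintegral_sub_eq {Ω : Type*} [MeasurableSpace Ω] {ν : Measure Ω} [IsProbabilityMeasure ν]
    {a₁ a₂ b₁ b₂ : Ω → ℝ} (ha₁ : MemLp a₁ 2 ν) (ha₂ : MemLp a₂ 2 ν) (hb₁ : MemLp b₁ 2 ν) (hb₂ : MemLp b₂ 2 ν) :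
    ∫ x, conj ((a₁ x : ℂ) + I * a₂ x) * ((b₁ x : ℂ) + I * b₂ x) ∂ν -
        (∫ x, conj ((a₁ x : ℂ) + I * a₂ x) ∂ν) * ∫ x, ((b₁ x : ℂ) + I * b₂ x) ∂ν =
      ((cov[a₁, b₁; ν] + cov[a₂, b₂; ν] : ℝ) : ℂ) + I * ((cov[a₁, b₂; ν] - cov[a₂, b₁; ν] : ℝ) : ℂ) := by
  have i1 : Integrable a₁ ν := ha₁.integrable one_le_two
  have i2 : Integrable a₂ ν := ha₂.integrable one_le_two
  have j1 : Integrable b₁ ν := hb₁.integrable one_le_two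
  have j2 : Integrable b₂ ν := hb₂.integrable one_le_two
  have i11 : Integrable (fun x => a₁ x * b₁ x) ν := ha₁.integrable_mul hb₁
  have i12 : Integrable (fun x => a₁ x * b₂ x) ν := ha₁.integrable_mul hb₂
  have i21 : Integrable (fun x => a₂ x * b₁ x) ν := ha₂.integrable_mul hb₁
  have i22 : Integrable (fun x => a₂ x * b₂ x) ν := ha₂.integrable_mul hb₂
  have hc : ∀ {f : Ω → ℝ}, Integrable f ν → Integrable (fun x => (f x : ℂ)) ν := fun hf => hf.ofReal
  -- the three complex integrals in terms of real ones
  have hAB : ∫ x, conj ((a₁ x : ℂ) + I * a₂ x) * ((b₁ x : ℂ) + I * b₂ x) ∂ν =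
      ((∫ x, a₁ x * b₁ x ∂ν : ℝ) : ℂ) + ((∫ x, a₂ x * b₂ x ∂ν : ℝ) : ℂ) +
        I * (((∫ x, a₁ x * b₂ x ∂ν : ℝ) : ℂ) - ((∫ x, a₂ x * b₁ x ∂ν : ℝ) : ℂ)) := by
    have e : ∀ x, conj ((a₁ x : ℂ) + I * a₂ x) * ((b₁ x : ℂ) + I * b₂ x) =
        ((a₁ x * b₁ x : ℝ) : ℂ) + ((a₂ x * b₂ x : ℝ) : ℂ) +
          I * (((a₁ x * b₂ x : ℝ) : ℂ) - ((a₂ x * b₁ x : ℝ) : ℂ)) := by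
      intro x
      simp only [map_add, map_mul, Complex.conj_ofReal, Complex.conj_I]
      push_cast
      linear_combination (-(a₂ x : ℂ) * b₂ x) * Complex.I_mul_I
    simp_rw [e]
    have hI1 : Integrable (fun x => ((a₁ x * b₁ x : ℝ) : ℂ) + ((a₂ x * b₂ x : ℝ) : ℂ)) ν :=
      (hc i11).add (hc i22)
    have hI2 : Integrable (fun x => I * (((a₁ x * b₂ x : ℝ) : ℂ) - ((a₂ x * b₁ x : ℝ) : ℂ))) ν :=
      ((hc i12).sub (hc i21)).const_mul I
    rw [integral_add hI1 hI2, integral_add (hc i11) (hc i22), integral_const_mul, integral_sub (hc i12) (hc i21),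
      integral_complex_ofReal, integral_complex_ofReal, integral_complex_ofReal, integral_complex_ofReal]
  have hA : ∫ x, conj ((a₁ x : ℂ) + I * a₂ x) ∂ν = ((∫ x, a₁ x ∂ν : ℝ) : ℂ) - I * ((∫ x, a₂ x ∂ν : ℝ) : ℂ) := by
    have e : ∀ x, conj ((a₁ x : ℂ) + I * a₂ x) = (a₁ x : ℂ) - I * (a₂ x : ℂ) := by
      intro x
      simp only [map_add, map_mul, Complex.conj_ofReal, Complex.conj_I]
      ring
    simp_rw [e]
    rw [integral_sub (hc i1) ((hc i2).const_mul I), integral_const_mul, integral_complex_ofReal,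
      integral_complex_ofReal]
  have hB : ∫ x, ((b₁ x : ℂ) + I * b₂ x) ∂ν = ((∫ x, b₁ x ∂ν : ℝ) : ℂ) + I * ((∫ x, b₂ x ∂ν : ℝ) : ℂ) := by
    rw [integral_add (hc j1) ((hc j2).const_mul I), integral_const_mul, integral_complex_ofReal,
      integral_complex_ofReal]
  rw [hAB, hA, hB, covariance_eq_sub ha₁ hb₁, covariance_eq_sub ha₂ hb₂, covariance_eq_sub ha₁ hb₂,
    covariance_eq_sub ha₂ hb₁]
  simp only [Pi.mul_apply]
  push_cast
  linear_combination ((∫ x, a₂ x ∂ν : ℝ) : ℂ) * ((∫ x, b₂ x ∂ν : ℝ) : ℂ) * Complex.I_mul_I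

/-- The norm of `x + iy` is at most `|x| + |y|`. [folklore] -/
private theorem norm_ofReal_add_I_mul_le (x y : ℝ) : ‖(x : ℂ) + I * y‖ ≤ |x| + |y| := by
  have h := Complex.norm_le_abs_re_add_abs_im ((x : ℂ) + I * y)
  simpa using h

/-- `‖x + iy‖² = x² + y²` for real `x, y`. [folklore] -/
private theorem norm_sq_ofReal_add_I_mul (x y : ℝ) : ‖(x : ℂ) + I * y‖ ^ 2 = x ^ 2 + y ^ 2 := by
  rw [Complex.sq_norm, Complex.normSq_apply]
  simp
  ring

/-- **Complex form of the maximal-correlation inequality.** For the Gaussian pair with covariance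
`[[1, K], [Kᵀ, 1]]`, `|uᵀKv| ≤ ρ|u||v|` (`0 ≤ ρ ≤ 1`), and complex polynomial statistics
`𝒜 = Q₁(ξ) + iQ₂(ξ)`, `ℬ = R₁(η) + iR₂(η)`:
`‖E[conj 𝒜 · ℬ] − E[conj 𝒜] E[ℬ]‖ ≤ 4ρ ‖𝒜‖₂ ‖ℬ‖₂` (split into four real covariances and apply
`abs_covariance_polynomial_le` to each). [cite: Janson1997, Theorem 10.11] -/
theorem norm_cintegral_sub_le_of_polynomial {K : Matrix ι κ ℝ} {ρ : ℝ} (hρ0 : 0 ≤ ρ) (hρ1 : ρ ≤ 1)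
    (hK : ∀ (u : ι → ℝ) (v : κ → ℝ), |u ⬝ᵥ (K *ᵥ v)| ≤ ρ * Real.sqrt (u ⬝ᵥ u) * Real.sqrt (v ⬝ᵥ v))
    (Q₁ Q₂ : MvPolynomial ι ℝ) (R₁ R₂ : MvPolynomial κ ℝ) :
    ‖∫ z, conj ((MvPolynomial.eval (xL z) Q₁ : ℂ) + I * MvPolynomial.eval (xL z) Q₂) *
          ((MvPolynomial.eval (xR z) R₁ : ℂ) + I * MvPolynomial.eval (xR z) R₂) ∂γm (SK K) -
        (∫ z, conj ((MvPolynomial.eval (xL z) Q₁ : ℂ) + I * MvPolynomial.eval (xL z) Q₂) ∂γm (SK K)) *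
          ∫ z, ((MvPolynomial.eval (xR z) R₁ : ℂ) + I * MvPolynomial.eval (xR z) R₂) ∂γm (SK K)‖ ≤
      4 * ρ * Real.sqrt (∫ z, ‖(MvPolynomial.eval (xL z) Q₁ : ℂ) + I * MvPolynomial.eval (xL z) Q₂‖ ^ 2 ∂γm (SK K)) *
        Real.sqrt (∫ z, ‖(MvPolynomial.eval (xR z) R₁ : ℂ) + I * MvPolynomial.eval (xR z) R₂‖ ^ 2 ∂γm (SK K)) := by
  set ν : Measure (EuclideanSpace ℝ (ι ⊕ κ)) := γm (SK K) with hν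
  set a₁ : EuclideanSpace ℝ (ι ⊕ κ) → ℝ := fun z => MvPolynomial.eval (xL z) Q₁
  set a₂ : EuclideanSpace ℝ (ι ⊕ κ) → ℝ := fun z => MvPolynomial.eval (xL z) Q₂
  set b₁ : EuclideanSpace ℝ (ι ⊕ κ) → ℝ := fun z => MvPolynomial.eval (xR z) R₁
  set b₂ : EuclideanSpace ℝ (ι ⊕ κ) → ℝ := fun z => MvPolynomial.eval (xR z) R₂
  -- integrability of polynomial statistics
  have hint : ∀ G : MvPolynomial (ι ⊕ κ) ℝ, Integrable (fun z => MvPolynomial.eval (ofLp z) G) ν :=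
    fun G => integrable_eval_mvPolynomial ν G
  have hcont : ∀ G : MvPolynomial (ι ⊕ κ) ℝ,
      AEStronglyMeasurable (fun z : EuclideanSpace ℝ (ι ⊕ κ) => MvPolynomial.eval (ofLp z) G) ν :=
    fun G => ((MvPolynomial.continuous_eval G).comp (PiLp.continuous_ofLp 2 _)).aestronglyMeasurable
  have hL : ∀ P : MvPolynomial ι ℝ, (fun z : EuclideanSpace ℝ (ι ⊕ κ) => MvPolynomial.eval (xL z) P) =
      fun z => MvPolynomial.eval (ofLp z) (MvPolynomial.rename Sum.inl P) := by
    intro P; funext z; rw [MvPolynomial.eval_rename]; rfl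
  have hR : ∀ P : MvPolynomial κ ℝ, (fun z : EuclideanSpace ℝ (ι ⊕ κ) => MvPolynomial.eval (xR z) P) =
      fun z => MvPolynomial.eval (ofLp z) (MvPolynomial.rename Sum.inr P) := by
    intro P; funext z; rw [MvPolynomial.eval_rename]; rfl
  have hmem : ∀ G : MvPolynomial (ι ⊕ κ) ℝ, MemLp (fun z : EuclideanSpace ℝ (ι ⊕ κ) => MvPolynomial.eval (ofLp z) G) 2 ν := by
    intro G
    rw [memLp_two_iff_integrable_sq (hcont G)]
    simpa [sq, map_mul] using hint (G * G)
  have ha₁ : MemLp a₁ 2 ν := by simp only [a₁, hL]; exact hmem _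
  have ha₂ : MemLp a₂ 2 ν := by simp only [a₂, hL]; exact hmem _
  have hb₁ : MemLp b₁ 2 ν := by simp only [b₁, hR]; exact hmem _
  have hb₂ : MemLp b₂ 2 ν := by simp only [b₂, hR]; exact hmem _
  -- the four real covariance bounds
  have hcv := fun (P : MvPolynomial ι ℝ) (Q : MvPolynomial κ ℝ) => abs_covariance_polynomial_le hρ0 hρ1 hK P Q
  -- variances bounded by second moments of `𝒜`, `ℬ`
  have hsqA : Integrable (fun z => ‖(a₁ z : ℂ) + I * a₂ z‖ ^ 2) ν := by
    simp_rw [norm_sq_ofReal_add_I_mul]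
    exact (ha₁.integrable_sq).add (ha₂.integrable_sq)
  have hsqB : Integrable (fun z => ‖(b₁ z : ℂ) + I * b₂ z‖ ^ 2) ν := by
    simp_rw [norm_sq_ofReal_add_I_mul]
    exact (hb₁.integrable_sq).add (hb₂.integrable_sq)
  have hvarA : ∀ {a a' : EuclideanSpace ℝ (ι ⊕ κ) → ℝ}, MemLp a 2 ν → MemLp a' 2 ν →
      Var[a; ν] ≤ ∫ z, ‖(a z : ℂ) + I * a' z‖ ^ 2 ∂ν ∧ Var[a'; ν] ≤ ∫ z, ‖(a z : ℂ) + I * a' z‖ ^ 2 ∂ν := by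
    intro a a' ha ha'
    simp_rw [norm_sq_ofReal_add_I_mul]
    have h1 := variance_le_expectation_sq (μ := ν) ha.aestronglyMeasurable
    have h2 := variance_le_expectation_sq (μ := ν) ha'.aestronglyMeasurable
    have h3 : ∫ z, a z ^ 2 ∂ν ≤ ∫ z, (a z ^ 2 + a' z ^ 2) ∂ν :=
      integral_mono ha.integrable_sq (ha.integrable_sq.add ha'.integrable_sq) fun z => by
        simp only [le_add_iff_nonneg_right]; positivity
    have h4 : ∫ z, a' z ^ 2 ∂ν ≤ ∫ z, (a z ^ 2 + a' z ^ 2) ∂ν :=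
      integral_mono ha'.integrable_sq (ha.integrable_sq.add ha'.integrable_sq) fun z => by
        simp only [le_add_iff_nonneg_left]; positivity
    exact ⟨h1.trans h3, h2.trans h4⟩
  obtain ⟨hv1, hv2⟩ := hvarA ha₁ ha₂
  obtain ⟨hw1, hw2⟩ := hvarA hb₁ hb₂
  set NA := Real.sqrt (∫ z, ‖(a₁ z : ℂ) + I * a₂ z‖ ^ 2 ∂ν)
  set NB := Real.sqrt (∫ z, ‖(b₁ z : ℂ) + I * b₂ z‖ ^ 2 ∂ν)
  have hs1 : Real.sqrt Var[a₁; ν] ≤ NA := Real.sqrt_le_sqrt hv1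
  have hs2 : Real.sqrt Var[a₂; ν] ≤ NA := Real.sqrt_le_sqrt hv2
  have ht1 : Real.sqrt Var[b₁; ν] ≤ NB := Real.sqrt_le_sqrt hw1
  have ht2 : Real.sqrt Var[b₂; ν] ≤ NB := Real.sqrt_le_sqrt hw2
  have hcb : ∀ {a b : EuclideanSpace ℝ (ι ⊕ κ) → ℝ} (P : MvPolynomial ι ℝ) (Q : MvPolynomial κ ℝ),
      a = (fun z => MvPolynomial.eval (xL z) P) → b = (fun z => MvPolynomial.eval (xR z) Q) →
      Real.sqrt Var[a; ν] ≤ NA → Real.sqrt Var[b; ν] ≤ NB → |cov[a, b; ν]| ≤ ρ * NA * NB := by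
    intro a b P Q ha hb hsa hsb
    have h := hcv P Q
    rw [← ha, ← hb] at h
    refine h.trans ?_
    have : 0 ≤ NA := Real.sqrt_nonneg _
    gcongr
  have c11 := hcb Q₁ R₁ rfl rfl hs1 ht1
  have c22 := hcb Q₂ R₂ rfl rfl hs2 ht2
  have c12 := hcb Q₁ R₂ rfl rfl hs1 ht2
  have c21 := hcb Q₂ R₁ rfl rfl hs2 ht1
  -- assemble
  have heq := cintegral_sub_eq (ν := ν) ha₁ ha₂ hb₁ hb₂
  change ‖∫ z, conj ((a₁ z : ℂ) + I * a₂ z) * ((b₁ z : ℂ) + I * b₂ z) ∂ν -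
      (∫ z, conj ((a₁ z : ℂ) + I * a₂ z) ∂ν) * ∫ z, ((b₁ z : ℂ) + I * b₂ z) ∂ν‖ ≤ 4 * ρ * NA * NB
  rw [heq]
  refine (norm_ofReal_add_I_mul_le _ _).trans ?_
  have e1 := abs_add_le (cov[a₁, b₁; ν]) (cov[a₂, b₂; ν])
  have e2 := abs_sub (cov[a₁, b₂; ν]) (cov[a₂, b₁; ν])
  linarith

end ComplexCorrelation


/-! ### D. Tensor polynomials with finitely many real factors and their field functionals -/

section TensorSum

variable {d : ℕ} {n k : ℕ} {β β' : Type*} [Fintype β] [Fintype β']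

variable (n) in
/-- The test function `∑_b w_b · f_{b,1} ⊗ ⋯ ⊗ f_{b,n}` of a finite family of real one-point factors
with complex weights (a presentation of the span of tensor products, GJ §6.1 (6.1.15)). [folklore] -/
def tensorSum (w : β → ℂ) (f : β → Fin n → 𝓢(EuclideanSpace ℝ (Fin d), ℝ)) :
    𝓢((Fin n → EuclideanSpace ℝ (Fin d)), ℂ) :=
  ∑ b, w b • SchwartzMap.tensorFin n fun i => ofRealTest (f b i)

/-- The field functional `ω ↦ ∑_b w_b ∏ᵢ ω(f_{b,i})` of a tensor sum. [folklore] -/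
def tensorSumFn (w : β → ℂ) (f : β → Fin n → 𝓢(EuclideanSpace ℝ (Fin d), ℝ))
    (ω : FieldConfig (EuclideanSpace ℝ (Fin d))) : ℂ :=
  ∑ b, w b * monomialFn (f b) ω

omit [Fintype β'] in
/-- `tensorSumFn` is continuous on configurations. [folklore] -/
private theorem continuous_tensorSumFn (w : β → ℂ) (f : β → Fin n → 𝓢(EuclideanSpace ℝ (Fin d), ℝ)) :
    Continuous (tensorSumFn w f) := by
  unfold tensorSumFn
  exact continuous_finsetSum _ fun b _ => continuous_const.mul (continuous_monomial _)

omit [Fintype β'] in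
/-- `Θ` acts on a tensor sum factorwise. [folklore] -/
private theorem thetaMulti_tensorSum [NeZero d] (w : β → ℂ) (f : β → Fin n → 𝓢(EuclideanSpace ℝ (Fin d), ℝ)) :
    thetaMulti d (tensorSum n w f) = tensorSum n w (fun b i => thetaTest d (f b i)) := by
  unfold tensorSum
  rw [map_sum]
  refine Finset.sum_congr rfl fun b _ => ?_
  rw [map_smul]
  congr 1
  exact ((isTensorOf_tensorFin _).linActMulti (timeReflection d)).unique (isTensorOf_tensorFin _)

omit [Fintype β'] in
/-- Time translation acts on a tensor sum factorwise. [folklore] -/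
private theorem translateMulti_single_tensorSum [NeZero d] (t : ℝ) (w : β → ℂ)
    (f : β → Fin n → 𝓢(EuclideanSpace ℝ (Fin d), ℝ)) :
    translateMulti (EuclideanSpace.single 0 t) (tensorSum n w f) =
      tensorSum n w (fun b i => timeShiftTest d t (f b i)) := by
  unfold tensorSum
  rw [map_sum]
  refine Finset.sum_congr rfl fun b _ => ?_
  rw [map_smul]
  congr 1
  exact ((isTensorOf_tensorFin _).translateMulti (EuclideanSpace.single 0 t)).unique (isTensorOf_tensorFin _)

variable {μ : Measure (FieldConfig (EuclideanSpace ℝ (Fin d)))} {S : SchwingerFamily (EuclideanSpace ℝ (Fin d))}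

omit [Fintype β'] in
/-- `𝔖ₙ` of a tensor sum is the expectation of its field functional (GJ §6.1 (6.1.15)). [cite: GlimmJaffeQP1987, §6.1 (6.1.15)] -/
theorem _root_.Literature.MathematicalPhysics.QuantumLattice.IsSchwingerFamilyOf.apply_tensorSum [IsFiniteMeasure μ]
    (hS : IsSchwingerFamilyOf μ S) (hμ : HasAllMoments μ) (w : β → ℂ)
    (f : β → Fin n → 𝓢(EuclideanSpace ℝ (Fin d), ℝ)) :
    S n (tensorSum n w f) = ∫ ω, tensorSumFn w f ω ∂μ := by
  unfold tensorSum tensorSumFn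
  have hint : ∀ b, Integrable (fun ω => w b * monomialFn (f b) ω) μ :=
    fun b => (hμ.integrable_monomial (f b)).const_mul (w b)
  rw [map_sum, integral_finsetSum _ fun b _ => hint b]
  refine Finset.sum_congr rfl fun b _ => ?_
  rw [map_smul, smul_eq_mul, hS.apply_tensorFin, integral_const_mul]

omit [Fintype β'] in
/-- `𝔖ₙ(F*) = conj 𝔖ₙ(F)` for tensor sums (real moments). [folklore] -/
private theorem apply_osStar_tensorSum
    (hS : IsSchwingerFamilyOf μ S) (w : β → ℂ) (f : β → Fin n → 𝓢(EuclideanSpace ℝ (Fin d), ℝ)) :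
    S n (osStar (tensorSum n w f)) = conj (S n (tensorSum n w f)) := by
  unfold tensorSum
  rw [osStar_sum, map_sum (S n), map_sum (S n), map_sum (starRingEnd ℂ)]
  refine Finset.sum_congr rfl fun b _ => ?_
  rw [osStar_smul, map_smul, map_smul, smul_eq_mul, smul_eq_mul, map_mul,
    (isTensorOf_tensorFin _).osStar.unique (isTensorOf_tensorFin _),
    hS n _ _ (isTensorOf_tensorFin _), hS n _ _ (isTensorOf_tensorFin _), Complex.conj_ofReal]
  have hperm := moment_comp_perm μ Fin.revPerm (f b)
  simp only [Fin.revPerm_apply] at hperm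
  rw [hperm]

/-- `𝔖ₙ₊ₖ(F* ⊗ G)` for tensor sums is the `L²(dμ)` pairing of the field functionals
(GJ §6.1 (6.1.15)). [cite: GlimmJaffeQP1987, §6.1 (6.1.15)] -/
theorem _root_.Literature.MathematicalPhysics.QuantumLattice.IsSchwingerFamilyOf.apply_osStar_tensorSum_appendTensor
    [IsFiniteMeasure μ] (hS : IsSchwingerFamilyOf μ S) (hμ : HasAllMoments μ) (w : β → ℂ)
    (f : β → Fin n → 𝓢(EuclideanSpace ℝ (Fin d), ℝ)) (w' : β' → ℂ)
    (g : β' → Fin k → 𝓢(EuclideanSpace ℝ (Fin d), ℝ)) :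
    S (n + k) ((osStar (tensorSum n w f)).appendTensor (tensorSum k w' g)) =
      ∫ ω, conj (tensorSumFn w f ω) * tensorSumFn w' g ω ∂μ := by
  unfold tensorSum
  rw [apply_osStar_appendTensor_sum_smul]
  simp only [hS.apply_osStar_appendTensor_tensorFin]
  have hrhs : (fun ω => conj (tensorSumFn w f ω) * tensorSumFn w' g ω) = fun ω =>
      ∑ b, ∑ b', conj (w b) * w' b' * (conj (monomialFn (f b) ω) * monomialFn (g b') ω) := by
    funext ω
    unfold tensorSumFn
    rw [map_sum (starRingEnd ℂ), Finset.sum_mul]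
    refine Finset.sum_congr rfl fun b _ => ?_
    rw [Finset.mul_sum]
    refine Finset.sum_congr rfl fun b' _ => ?_
    rw [map_mul]
    ring
  rw [hrhs, integral_finsetSum _ fun b _ => integrable_finsetSum _ fun b' _ =>
    (hμ.integrable_conj_monomialFn_mul (f b) (g b')).const_mul _]
  refine Finset.sum_congr rfl fun b _ => ?_
  rw [integral_finsetSum _ fun b' _ => (hμ.integrable_conj_monomialFn_mul (f b) (g b')).const_mul _]
  refine Finset.sum_congr rfl fun b' _ => ?_
  rw [integral_const_mul]

omit [Fintype β'] in
/-- `N(F) = Re 𝔖₂ₙ(F* ⊗ F) = ∫ |P_F|² dμ` for tensor sums (GJ §6.1 (6.1.15)). [cite: GlimmJaffeQP1987, §6.1 (6.1.15)] -/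
theorem _root_.Literature.MathematicalPhysics.QuantumLattice.IsSchwingerFamilyOf.sqNorm_tensorSum [IsFiniteMeasure μ]
    (hS : IsSchwingerFamilyOf μ S) (hμ : HasAllMoments μ) (w : β → ℂ)
    (f : β → Fin n → 𝓢(EuclideanSpace ℝ (Fin d), ℝ)) :
    S.sqNorm n (tensorSum n w f) = ∫ ω, ‖tensorSumFn w f ω‖ ^ 2 ∂μ := by
  rw [SchwingerFamily.sqNorm, hS.apply_osStar_tensorSum_appendTensor hμ]
  have : (fun ω => conj (tensorSumFn w f ω) * tensorSumFn w f ω) =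
      fun ω => ((‖tensorSumFn w f ω‖ ^ 2 : ℝ) : ℂ) := by
    funext ω; rw [Complex.conj_mul', Complex.ofReal_pow]
  rw [this, integral_complex_ofReal, Complex.ofReal_re]

/-- Tensor sums with positive-time factors present the span of the positive-time tensor products. [folklore] -/
private theorem exists_tensorSum_of_mem_span [NeZero d] {F : 𝓢((Fin n → EuclideanSpace ℝ (Fin d)), ℂ)}
    (hF : F ∈ Submodule.span ℂ (positiveTensorProducts (d := d) n)) :
    ∃ (N : ℕ) (w : Fin N → ℂ) (f : Fin N → Fin n → 𝓢(EuclideanSpace ℝ (Fin d), ℝ)),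
      (∀ b i, IsPositiveTime (f b i)) ∧ F = tensorSum n w f := by
  obtain ⟨N, w, g, hsum⟩ := Submodule.mem_span_set'.1 hF
  have hg : ∀ b, ∃ f : Fin n → 𝓢(EuclideanSpace ℝ (Fin d), ℝ),
      (∀ i, IsPositiveTime (f i)) ∧ IsTensorOf (g b : 𝓢((Fin n → EuclideanSpace ℝ (Fin d)), ℂ))
        fun i => ofRealTest (f i) := fun b => (g b).2
  choose f hf hT using hg
  refine ⟨N, w, f, hf, ?_⟩
  rw [← hsum, tensorSum]
  refine Finset.sum_congr rfl fun b _ => ?_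
  rw [(hT b).unique (isTensorOf_tensorFin _)]

end TensorSum

/-! ### E. The truncation bound for the free field on tensor sums -/

section FieldSide

open Literature.Probability.Distributions.GaussianHermite (xL xR γm SK)

variable {n : ℕ} {β : Type*} [Fintype β] {r : ℕ}

/-- The product `∏ᵢ (∑ₐ c_{ia} Xₐ)` of linear forms. [folklore] -/
def mixPoly (c : Fin n → Fin r → ℝ) : MvPolynomial (Fin r) ℝ :=
  ∏ i, ∑ a, MvPolynomial.C (c i a) * MvPolynomial.X a

/-- Real part polynomial `∑_b Re(w_b) ∏ᵢ (∑ₐ c_{bia} Xₐ)`. [folklore] -/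
def rePoly (w : β → ℂ) (c : β → Fin n → Fin r → ℝ) : MvPolynomial (Fin r) ℝ :=
  ∑ b, MvPolynomial.C (w b).re * mixPoly (c b)

/-- Imaginary part polynomial `∑_b Im(w_b) ∏ᵢ (∑ₐ c_{bia} Xₐ)`. [folklore] -/
def imPoly (w : β → ℂ) (c : β → Fin n → Fin r → ℝ) : MvPolynomial (Fin r) ℝ :=
  ∑ b, MvPolynomial.C (w b).im * mixPoly (c b)

omit [Fintype β] in
/-- Evaluation of `mixPoly`. [folklore] -/
private theorem eval_mixPoly (c : Fin n → Fin r → ℝ) (x : Fin r → ℝ) :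
    MvPolynomial.eval x (mixPoly c) = ∏ i, ∑ a, c i a * x a := by
  simp [mixPoly, map_prod, map_sum]

/-- `Re`/`Im` polynomials recombine to the complex tensor-sum functional in the reduced variables. [folklore] -/
private theorem rePoly_add_I_imPoly (w : β → ℂ) (c : β → Fin n → Fin r → ℝ) (x : Fin r → ℝ) :
    (MvPolynomial.eval x (rePoly w c) : ℂ) + I * MvPolynomial.eval x (imPoly w c) =
      ∑ b, w b * ∏ i, ((∑ a, c b i a * x a : ℝ) : ℂ) := by
  simp only [rePoly, imPoly, map_sum, map_mul, MvPolynomial.eval_C, eval_mixPoly]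
  push_cast
  rw [Finset.mul_sum, ← Finset.sum_add_distrib]
  refine Finset.sum_congr rfl fun b _ => ?_
  calc ((w b).re : ℂ) * ∏ i, ∑ a, ((c b i a : ℝ) : ℂ) * x a +
        I * (((w b).im : ℂ) * ∏ i, ∑ a, ((c b i a : ℝ) : ℂ) * x a)
      = (((w b).re : ℂ) + (w b).im * I) * ∏ i, ∑ a, ((c b i a : ℝ) : ℂ) * x a := by ring
    _ = w b * ∏ i, ∑ a, ((c b i a : ℝ) : ℂ) * x a := by rw [Complex.re_add_im]

/-- Continuity of `z ↦ P(ξ-block of z)`. [folklore] -/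
private theorem continuous_eval_xL {ι κ : Type*} (P : MvPolynomial ι ℝ) :
    Continuous fun z : EuclideanSpace ℝ (ι ⊕ κ) => MvPolynomial.eval (xL z) P := by
  have : (fun z : EuclideanSpace ℝ (ι ⊕ κ) => MvPolynomial.eval (xL z) P) =
      fun z => MvPolynomial.eval (ofLp z) (MvPolynomial.rename Sum.inl P) := by
    funext z; rw [MvPolynomial.eval_rename]; rfl
  rw [this]
  exact (MvPolynomial.continuous_eval _).comp (PiLp.continuous_ofLp 2 _)

/-- Continuity of `z ↦ P(η-block of z)`. [folklore] -/
private theorem continuous_eval_xR {ι κ : Type*} (P : MvPolynomial κ ℝ) :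
    Continuous fun z : EuclideanSpace ℝ (ι ⊕ κ) => MvPolynomial.eval (xR z) P := by
  have : (fun z : EuclideanSpace ℝ (ι ⊕ κ) => MvPolynomial.eval (xR z) P) =
      fun z => MvPolynomial.eval (ofLp z) (MvPolynomial.rename Sum.inr P) := by
    funext z; rw [MvPolynomial.eval_rename]; rfl
  rw [this]
  exact (MvPolynomial.continuous_eval _).comp (PiLp.continuous_ofLp 2 _)

variable {d : ℕ} [NeZero d] {m : ℝ} {μ : Measure (FieldConfig (EuclideanSpace ℝ (Fin d)))}
variable {k : ℕ} {β' : Type*} [Fintype β']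

omit [NeZero d] in
/-- A `C_m`-null test function is evaluated to `0` almost surely under the free field. [folklore] -/
private theorem ae_eval_eq_zero (h : IsFreeField m μ)
    {ρ : 𝓢(EuclideanSpace ℝ (Fin d), ℝ)} (hρ : freeCovarianceReal m ρ ρ = 0) :
    ∀ᵐ ω ∂μ, ω ρ = 0 := by
  have h1 : ∫ ω, (ω ρ) ^ 2 ∂μ = 0 := by rw [h.integral_eval_sq, hρ]
  have hint : Integrable (fun ω : FieldConfig (EuclideanSpace ℝ (Fin d)) => (ω ρ) ^ 2) μ :=
    (h.1.memLp_eval ρ 2 (by simp)).integrable_sq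
  have h2 := (integral_eq_zero_iff_of_nonneg (fun ω => sq_nonneg _) hint).1 h1
  filter_upwards [h2] with ω hω
  exact (pow_eq_zero_iff two_ne_zero).1 hω

/-- **Truncation bound for the free field on tensor sums** (Glimm–Jaffe Thm. 6.2.4 / Cor. 6.2.7 —
the free Hamiltonian is `dΓ(μ)`, `μ ≥ m` — realised probabilistically: the finitely many field
evaluations involved form a Gaussian vector whose negative-time/positive-time blocks have canonical
correlation `≤ e^{-mt}` by the one-particle bound, and the Gaussian maximal-correlation inequality
(Janson Thm. 10.11) bounds the covariance of arbitrary polynomial statistics of the two blocks).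
For `φ` negative-time, `ψ` positive-time real factors, complex weights `w, w'` and `t ≥ 0`:
`‖E[conj A · B_t] − E[conj A] E[B_t]‖ ≤ 4 e^{-mt} ‖A‖₂ ‖B_t‖₂`, `A = ∑ w_b ∏ ω(φ_{bi})`,
`B_t = ∑ w'_b ∏ ω(T_t ψ_{bj})`. [cite: GlimmJaffeQP1987, Thm. 6.2.4 and Cor. 6.2.7] [cite: Janson1997, Theorem 10.11] -/
theorem _root_.Literature.MathematicalPhysics.QuantumLattice.IsFreeField.norm_cintegral_tensorSumFn_sub_le
    (hm : 0 < m) (h : IsFreeField m μ) (w : β → ℂ) (w' : β' → ℂ)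
    {φ : β → Fin n → 𝓢(EuclideanSpace ℝ (Fin d), ℝ)} {ψ : β' → Fin k → 𝓢(EuclideanSpace ℝ (Fin d), ℝ)}
    (hφ : ∀ b i, IsPositiveTime (thetaTest d (φ b i))) (hψ : ∀ b j, IsPositiveTime (ψ b j))
    {t : ℝ} (ht : 0 ≤ t) :
    ‖∫ ω, conj (tensorSumFn w φ ω) * tensorSumFn w' (fun b j => timeShiftTest d t (ψ b j)) ω ∂μ -
        (∫ ω, conj (tensorSumFn w φ ω) ∂μ) *
          ∫ ω, tensorSumFn w' (fun b j => timeShiftTest d t (ψ b j)) ω ∂μ‖ ≤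
      4 * Real.exp (-(m * t)) * Real.sqrt (∫ ω, ‖tensorSumFn w φ ω‖ ^ 2 ∂μ) *
        Real.sqrt (∫ ω, ‖tensorSumFn w' (fun b j => timeShiftTest d t (ψ b j)) ω‖ ^ 2 ∂μ) := by
  classical
  haveI : IsGaussian μ := h.1.1
  -- Step 1: orthonormal reduction of both families
  obtain ⟨r, e, c, he_on, he_span, he_null⟩ :=
    exists_orthonormal_reduction (E := EuclideanSpace ℝ (Fin d)) hm.ne' (fun p : β × Fin n => φ p.1 p.2)
  obtain ⟨r', e', c', he'_on, he'_span, he'_null⟩ :=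
    exists_orthonormal_reduction (E := EuclideanSpace ℝ (Fin d)) hm.ne' (fun p : β' × Fin k => ψ p.1 p.2)
  -- supports of linear combinations
  have hneg : ∀ u : Fin r → ℝ, IsPositiveTime (thetaTest d (∑ a, u a • e a)) := by
    intro u
    set V : Submodule ℝ 𝓢(EuclideanSpace ℝ (Fin d), ℝ) :=
      (positiveTimeSubmodule ℝ d).comap
        ((thetaTest (𝕜 := ℝ) d : 𝓢(EuclideanSpace ℝ (Fin d), ℝ) →L[ℝ] 𝓢(EuclideanSpace ℝ (Fin d), ℝ)) :
          𝓢(EuclideanSpace ℝ (Fin d), ℝ) →ₗ[ℝ] 𝓢(EuclideanSpace ℝ (Fin d), ℝ)) with hV_def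
    have hV : ∀ f, f ∈ V ↔ IsPositiveTime (thetaTest d f) := fun f => Iff.rfl
    have hspan : Submodule.span ℝ (Set.range fun p : β × Fin n => φ p.1 p.2) ≤ V :=
      Submodule.span_le.2 (by rintro _ ⟨p, rfl⟩; exact (hV _).2 (hφ p.1 p.2))
    exact (hV _).1 (V.sum_mem fun a _ => V.smul_mem _ (hspan (he_span a)))
  have hpos : ∀ v : Fin r' → ℝ, IsPositiveTime (∑ b, v b • e' b) := by
    intro v
    have hspan : Submodule.span ℝ (Set.range fun p : β' × Fin k => ψ p.1 p.2) ≤ positiveTimeSubmodule ℝ d :=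
      Submodule.span_le.2 (by rintro _ ⟨p, rfl⟩; exact hψ p.1 p.2)
    exact (positiveTimeSubmodule ℝ d).sum_mem fun b _ =>
      (positiveTimeSubmodule ℝ d).smul_mem _ (hspan (he'_span b))
  -- Step 2: the cross-covariance matrix and its canonical-correlation bound
  set K : Matrix (Fin r) (Fin r') ℝ :=
    Matrix.of fun a b => freeCovarianceReal m (e a) (timeShiftTest d t (e' b)) with hK_def
  have hρ0 : 0 ≤ Real.exp (-(m * t)) := (Real.exp_pos _).le
  have hρ1 : Real.exp (-(m * t)) ≤ 1 := Real.exp_le_one_iff.2 (by nlinarith)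
  have hgram_e : freeCovGram m e = 1 := by
    ext a b; rw [freeCovGram_apply, he_on, Matrix.one_apply]
  have hgram_e' : freeCovGram m e' = 1 := by
    ext a b; rw [freeCovGram_apply, he'_on, Matrix.one_apply]
  have hK : ∀ (u : Fin r → ℝ) (v : Fin r' → ℝ),
      |u ⬝ᵥ (K *ᵥ v)| ≤ Real.exp (-(m * t)) * Real.sqrt (u ⬝ᵥ u) * Real.sqrt (v ⬝ᵥ v) := by
    intro u v
    have h1 : u ⬝ᵥ (K *ᵥ v) =
        freeCovarianceReal m (∑ a, u a • e a) (timeShiftTest d t (∑ b, v b • e' b)) := by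
      rw [map_sum]
      simp_rw [map_smul]
      have : K = freeCovGram₂ m e (fun b => timeShiftTest d t (e' b)) := rfl
      rw [this, dotProduct_freeCovGram₂_mulVec hm.ne']
    have h2 : u ⬝ᵥ u = freeCovarianceReal m (∑ a, u a • e a) (∑ a, u a • e a) := by
      rw [← dotProduct_covGram_mulVec hm.ne', hgram_e, Matrix.one_mulVec]
    have h3 : v ⬝ᵥ v = freeCovarianceReal m (∑ b, v b • e' b) (∑ b, v b • e' b) := by
      rw [← dotProduct_covGram_mulVec hm.ne', hgram_e', Matrix.one_mulVec]
    rw [h1, h2, h3]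
    exact abs_freeCovarianceReal_timeShiftTest_le_exp hm (hneg u) (hpos v) ht
  -- Step 3: the joint law of the reduced evaluations is `N(0, [[1, K], [Kᵀ, 1]])`
  set s : Fin r ⊕ Fin r' → 𝓢(EuclideanSpace ℝ (Fin d), ℝ) :=
    Sum.elim e (fun b => timeShiftTest d t (e' b)) with hs_def
  have hgram : freeCovGram m s = SK K := by
    ext i j
    rcases i with a | a <;> rcases j with b | b
    · simp [hs_def, SK, he_on, Matrix.one_apply]
    · simp [hs_def, SK, hK_def]
    · simp [hs_def, SK, hK_def, freeCovarianceReal_comm]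
    · simp [hs_def, SK, freeCovarianceReal_timeShiftTest, he'_on, Matrix.one_apply]
  have hlaw : μ.map (evalVec s) = γm (SK K) := by
    rw [← hgram]; exact h.map_evalVec hm.ne' s
  have hZ : AEMeasurable (evalVec s) μ := (evalVec s).continuous.measurable.aemeasurable
  -- Step 4: almost-sure linear reduction of the evaluations
  have hae1 : ∀ᵐ ω ∂μ, ∀ p : β × Fin n, ω (φ p.1 p.2) = ∑ a, c p a * ω (e a) := by
    rw [ae_all_iff]
    intro p
    filter_upwards [ae_eval_eq_zero h (he_null p)] with ω hω
    rw [map_sub, map_sum] at hω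
    simp only [map_smul, smul_eq_mul] at hω
    exact sub_eq_zero.1 hω
  have hae2 : ∀ᵐ ω ∂μ, ∀ p : β' × Fin k,
      ω (timeShiftTest d t (ψ p.1 p.2)) = ∑ a, c' p a * ω (timeShiftTest d t (e' a)) := by
    rw [ae_all_iff]
    intro p
    have hnull : freeCovarianceReal m (timeShiftTest d t (ψ p.1 p.2 - ∑ a, c' p a • e' a))
        (timeShiftTest d t (ψ p.1 p.2 - ∑ a, c' p a • e' a)) = 0 := by
      rw [freeCovarianceReal_timeShiftTest]; exact he'_null p
    filter_upwards [ae_eval_eq_zero h hnull] with ω hω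
    rw [map_sub, map_sum, map_sub, map_sum] at hω
    simp only [map_smul, smul_eq_mul] at hω
    exact sub_eq_zero.1 hω
  -- Step 5: the polynomial statistics on `ℝ^{r ⊕ r'}`
  set cc : β → Fin n → Fin r → ℝ := fun b i a => c (b, i) a with hcc
  set cc' : β' → Fin k → Fin r' → ℝ := fun b j a => c' (b, j) a with hcc'
  set 𝒜 : EuclideanSpace ℝ (Fin r ⊕ Fin r') → ℂ := fun z =>
    (MvPolynomial.eval (xL z) (rePoly w cc) : ℂ) + I * MvPolynomial.eval (xL z) (imPoly w cc) with h𝒜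
  set ℬ : EuclideanSpace ℝ (Fin r ⊕ Fin r') → ℂ := fun z =>
    (MvPolynomial.eval (xR z) (rePoly w' cc') : ℂ) + I * MvPolynomial.eval (xR z) (imPoly w' cc') with hℬ
  have hc𝒜 : Continuous 𝒜 :=
    (continuous_ofReal.comp (continuous_eval_xL _)).add
      (continuous_const.mul (continuous_ofReal.comp (continuous_eval_xL _)))
  have hcℬ : Continuous ℬ :=
    (continuous_ofReal.comp (continuous_eval_xR _)).add
      (continuous_const.mul (continuous_ofReal.comp (continuous_eval_xR _)))
  have hA : ∀ᵐ ω ∂μ, tensorSumFn w φ ω = 𝒜 (evalVec s ω) := by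
    filter_upwards [hae1] with ω hω
    rw [h𝒜]
    simp only
    rw [rePoly_add_I_imPoly]
    unfold tensorSumFn monomialFn
    refine Finset.sum_congr rfl fun b _ => ?_
    congr 1
    refine Finset.prod_congr rfl fun i _ => ?_
    rw [hω (b, i)]
    simp [hcc, hs_def, xL]
  have hB : ∀ᵐ ω ∂μ, tensorSumFn w' (fun b j => timeShiftTest d t (ψ b j)) ω = ℬ (evalVec s ω) := by
    filter_upwards [hae2] with ω hω
    rw [hℬ]
    simp only
    rw [rePoly_add_I_imPoly]
    unfold tensorSumFn monomialFn
    refine Finset.sum_congr rfl fun b _ => ?_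
    congr 1
    refine Finset.prod_congr rfl fun j _ => ?_
    rw [hω (b, j)]
    simp [hcc', hs_def, xR]
  -- Step 6: transfer the five integrals to the Gaussian vector
  have m1 : AEStronglyMeasurable (fun z => conj (𝒜 z) * ℬ z) (μ.map (evalVec s)) :=
    ((continuous_conj.comp hc𝒜).mul hcℬ).aestronglyMeasurable
  have m2 : AEStronglyMeasurable (fun z => conj (𝒜 z)) (μ.map (evalVec s)) :=
    (continuous_conj.comp hc𝒜).aestronglyMeasurable
  have m3 : AEStronglyMeasurable ℬ (μ.map (evalVec s)) := hcℬ.aestronglyMeasurable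
  have m4 : AEStronglyMeasurable (fun z => ‖𝒜 z‖ ^ 2) (μ.map (evalVec s)) :=
    (hc𝒜.norm.pow 2).aestronglyMeasurable
  have m5 : AEStronglyMeasurable (fun z => ‖ℬ z‖ ^ 2) (μ.map (evalVec s)) :=
    (hcℬ.norm.pow 2).aestronglyMeasurable
  have I1 : ∫ ω, conj (tensorSumFn w φ ω) * tensorSumFn w' (fun b j => timeShiftTest d t (ψ b j)) ω ∂μ =
      ∫ z, conj (𝒜 z) * ℬ z ∂γm (SK K) := by
    rw [← hlaw, integral_map hZ m1]
    refine integral_congr_ae ?_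
    filter_upwards [hA, hB] with ω h1 h2
    rw [h1, h2]
  have I2 : ∫ ω, conj (tensorSumFn w φ ω) ∂μ = ∫ z, conj (𝒜 z) ∂γm (SK K) := by
    rw [← hlaw, integral_map hZ m2]
    refine integral_congr_ae ?_
    filter_upwards [hA] with ω h1
    rw [h1]
  have I3 : ∫ ω, tensorSumFn w' (fun b j => timeShiftTest d t (ψ b j)) ω ∂μ = ∫ z, ℬ z ∂γm (SK K) := by
    rw [← hlaw, integral_map hZ m3]
    exact integral_congr_ae hB
  have I4 : ∫ ω, ‖tensorSumFn w φ ω‖ ^ 2 ∂μ = ∫ z, ‖𝒜 z‖ ^ 2 ∂γm (SK K) := by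
    rw [← hlaw, integral_map hZ m4]
    refine integral_congr_ae ?_
    filter_upwards [hA] with ω h1
    rw [h1]
  have I5 : ∫ ω, ‖tensorSumFn w' (fun b j => timeShiftTest d t (ψ b j)) ω‖ ^ 2 ∂μ =
      ∫ z, ‖ℬ z‖ ^ 2 ∂γm (SK K) := by
    rw [← hlaw, integral_map hZ m5]
    refine integral_congr_ae ?_
    filter_upwards [hB] with ω h1
    rw [h1]
  rw [I1, I2, I3, I4, I5]
  exact norm_cintegral_sub_le_of_polynomial hρ0 hρ1 hK _ _ _ _

end FieldSide


/-! ### F. The truncation bound on the Schwinger side; density; the mass gap -/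

section SchwingerSide

variable {d : ℕ} [NeZero d] {m : ℝ} {μ : Measure (FieldConfig (EuclideanSpace ℝ (Fin d)))}
  {S : SchwingerFamily (EuclideanSpace ℝ (Fin d))} {n k : ℕ} {β β' : Type*} [Fintype β] [Fintype β']

/-- **Truncation bound on the spans** (Glimm–Jaffe Thm. 6.2.4 for the free field, all degrees): for
the Schwinger family `𝔖` of the free field of mass `m > 0` (Euclidean covariant), tensor sums `F`, `G`
with positive-time real factors and `t ≥ 0`,
`‖𝔖ₙ₊ₖ(ΘF* ⊗ T_t G) − 𝔖ₙ(ΘF*) 𝔖ₖ(G)‖ ≤ e^{-mt} · 4 N(F)^{1/2} N(G)^{1/2}`, `N(F) = Re 𝔖₂ₙ(F* ⊗ F)`.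
[cite: GlimmJaffeQP1987, Thm. 6.2.4 and Cor. 6.2.7] -/
theorem _root_.Literature.MathematicalPhysics.QuantumLattice.IsFreeField.norm_truncated_tensorSum_le
    (hm : 0 < m) (h : IsFreeField m μ) (hS : IsSchwingerFamilyOf μ S) (hE1 : S.IsEuclideanCovariant)
    (w : β → ℂ) (w' : β' → ℂ) {f : β → Fin n → 𝓢(EuclideanSpace ℝ (Fin d), ℝ)}
    {g : β' → Fin k → 𝓢(EuclideanSpace ℝ (Fin d), ℝ)} (hf : ∀ b i, IsPositiveTime (f b i))
    (hg : ∀ b j, IsPositiveTime (g b j)) {t : ℝ} (ht : 0 ≤ t) :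
    ‖S (n + k) ((osAdjoint (tensorSum n w f)).appendTensor
          (translateMulti (EuclideanSpace.single 0 t) (tensorSum k w' g))) -
        S n (osAdjoint (tensorSum n w f)) * S k (tensorSum k w' g)‖ ≤
      Real.exp (-m * t) * (4 * Real.sqrt (S.sqNorm n (tensorSum n w f)) *
        Real.sqrt (S.sqNorm k (tensorSum k w' g))) := by
  haveI : IsGaussian μ := h.1.1
  have hμ : HasAllMoments μ := fun p φ => h.1.memLp_eval φ p ENNReal.coe_ne_top
  set fθ : β → Fin n → 𝓢(EuclideanSpace ℝ (Fin d), ℝ) := fun b i => thetaTest d (f b i) with hfθ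
  set gt : β' → Fin k → 𝓢(EuclideanSpace ℝ (Fin d), ℝ) := fun b j => timeShiftTest d t (g b j) with hgt
  have hfθ' : ∀ b i, IsPositiveTime (thetaTest d (fθ b i)) := fun b i => by
    simp only [hfθ]; rw [thetaTest_involutive d (f b i)]; exact hf b i
  have h1 : osAdjoint (tensorSum n w f) = osStar (tensorSum n w fθ) := by
    rw [← osStar_thetaMulti, thetaMulti_tensorSum]
  have h2 : translateMulti (EuclideanSpace.single 0 t) (tensorSum k w' g) = tensorSum k w' gt :=
    translateMulti_single_tensorSum t w' g
  have eAB : S (n + k) ((osAdjoint (tensorSum n w f)).appendTensor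
      (translateMulti (EuclideanSpace.single 0 t) (tensorSum k w' g))) =
      ∫ ω, conj (tensorSumFn w fθ ω) * tensorSumFn w' gt ω ∂μ := by
    rw [h1, h2, hS.apply_osStar_tensorSum_appendTensor hμ]
  have eA : S n (osAdjoint (tensorSum n w f)) = ∫ ω, conj (tensorSumFn w fθ ω) ∂μ := by
    rw [h1, apply_osStar_tensorSum hS, hS.apply_tensorSum hμ, integral_conj]
  have eB : S k (tensorSum k w' g) = ∫ ω, tensorSumFn w' gt ω ∂μ := by
    rw [← hE1.translateMulti k (EuclideanSpace.single 0 t) (tensorSum k w' g), h2, hS.apply_tensorSum hμ]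
  have eNA : S.sqNorm n (tensorSum n w f) = ∫ ω, ‖tensorSumFn w fθ ω‖ ^ 2 ∂μ := by
    rw [← hS.sqNorm_tensorSum hμ, ← thetaMulti_tensorSum]
    exact (hE1.sqNorm_linActMulti n (timeReflection d) (tensorSum n w f)).symm
  have eNB : S.sqNorm k (tensorSum k w' g) = ∫ ω, ‖tensorSumFn w' gt ω‖ ^ 2 ∂μ := by
    rw [← hS.sqNorm_tensorSum hμ, ← h2]
    exact (hE1.sqNorm_translateMulti k (EuclideanSpace.single 0 t) (tensorSum k w' g)).symm
  rw [eAB, eA, eB, eNA, eNB]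
  calc _ ≤ _ := h.norm_cintegral_tensorSumFn_sub_le hm w w' hfθ' hg ht
    _ = _ := by rw [neg_mul]; ring

omit [NeZero d] in
/-- **Closure step**: a bound `‖𝔖ₙ₊ₖ(ΘF* ⊗ T_t G) − 𝔖ₙ(ΘF*) 𝔖ₖ(G)‖ ≤ e^{−Δt} Nₙ(F) Nₖ(G)` with
CONTINUOUS functionals `Nₙ, Nₖ`, valid on the spans of the positive-time tensor products, extends to
all positive-time `F, G` (both sides are continuous in `(F, G)`; density of positive-time tensor
products, OS 1973 §2). [cite: OsterwalderSchraderCMP1973, §2 pp. 86–87] -/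
theorem _root_.Literature.MathematicalPhysics.QuantumLattice.SchwingerFamily.truncated_bound_of_span [NeZero d]
    (S : SchwingerFamily (EuclideanSpace ℝ (Fin d))) {Δ : ℝ}
    (Nn : 𝓢((Fin n → EuclideanSpace ℝ (Fin d)), ℂ) → ℝ) (Nk : 𝓢((Fin k → EuclideanSpace ℝ (Fin d)), ℂ) → ℝ)
    (hNn : Continuous Nn) (hNk : Continuous Nk)
    (h : ∀ F ∈ Submodule.span ℂ (positiveTensorProducts (d := d) n),
      ∀ G ∈ Submodule.span ℂ (positiveTensorProducts (d := d) k), ∀ t : ℝ, 0 ≤ t →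
        ‖S (n + k) ((osAdjoint F).appendTensor (translateMulti (EuclideanSpace.single 0 t) G)) -
            S n (osAdjoint F) * S k G‖ ≤ Real.exp (-Δ * t) * (Nn F * Nk G))
    {F : 𝓢((Fin n → EuclideanSpace ℝ (Fin d)), ℂ)} {G : 𝓢((Fin k → EuclideanSpace ℝ (Fin d)), ℂ)}
    (hF : IsPositiveTimeMulti F) (hG : IsPositiveTimeMulti G) {t : ℝ} (ht : 0 ≤ t) :
    ‖S (n + k) ((osAdjoint F).appendTensor (translateMulti (EuclideanSpace.single 0 t) G)) -
        S n (osAdjoint F) * S k G‖ ≤ Real.exp (-Δ * t) * (Nn F * Nk G) := by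
  obtain ⟨Φ, hΦ⟩ : ∃ Φ : 𝓢((Fin n → EuclideanSpace ℝ (Fin d)), ℂ) × 𝓢((Fin k → EuclideanSpace ℝ (Fin d)), ℂ) → ℂ,
      ∀ pq, Φ pq = S (n + k) ((osAdjoint pq.1).appendTensor (translateMulti (EuclideanSpace.single 0 t) pq.2)) -
        S n (osAdjoint pq.1) * S k pq.2 := ⟨_, fun _ => rfl⟩
  have hΦc : Continuous Φ := by
    rw [show Φ = fun pq => S (n + k) ((osAdjoint pq.1).appendTensor
        (translateMulti (EuclideanSpace.single 0 t) pq.2)) - S n (osAdjoint pq.1) * S k pq.2 from funext hΦ]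
    refine Continuous.sub ?_ (Continuous.mul ?_ ?_)
    · exact (S (n + k)).continuous.comp (continuous_appendTensor.comp
        ((continuous_osAdjoint.comp continuous_fst).prodMk
          ((translateMulti (EuclideanSpace.single (0 : Fin d) t)).continuous.comp continuous_snd)))
    · exact (S n).continuous.comp (continuous_osAdjoint.comp continuous_fst)
    · exact (S k).continuous.comp continuous_snd
  have hclosed : IsClosed {pq : 𝓢((Fin n → EuclideanSpace ℝ (Fin d)), ℂ) ×
      𝓢((Fin k → EuclideanSpace ℝ (Fin d)), ℂ) | ‖Φ pq‖ ≤ Real.exp (-Δ * t) * (Nn pq.1 * Nk pq.2)} :=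
    isClosed_le (continuous_norm.comp hΦc)
      (continuous_const.mul ((hNn.comp continuous_fst).mul (hNk.comp continuous_snd)))
  have hsub : ((Submodule.span ℂ (positiveTensorProducts (d := d) n) :
        Set 𝓢((Fin n → EuclideanSpace ℝ (Fin d)), ℂ)) ×ˢ
      (Submodule.span ℂ (positiveTensorProducts (d := d) k) :
        Set 𝓢((Fin k → EuclideanSpace ℝ (Fin d)), ℂ))) ⊆
      {pq | ‖Φ pq‖ ≤ Real.exp (-Δ * t) * (Nn pq.1 * Nk pq.2)} := by
    intro pq hpq
    rw [Set.mem_setOf_eq, hΦ]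
    exact h pq.1 hpq.1 pq.2 hpq.2 t ht
  have hmem : (F, G) ∈ closure (((Submodule.span ℂ (positiveTensorProducts (d := d) n) :
        Set 𝓢((Fin n → EuclideanSpace ℝ (Fin d)), ℂ)) ×ˢ
      (Submodule.span ℂ (positiveTensorProducts (d := d) k) :
        Set 𝓢((Fin k → EuclideanSpace ℝ (Fin d)), ℂ)))) := by
    rw [closure_prod_eq]
    exact ⟨IsPositiveTimeMulti.mem_closure_span_positiveTensorProducts_holds n F hF,
      IsPositiveTimeMulti.mem_closure_span_positiveTensorProducts_holds k G hG⟩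
  have hfin := hclosed.closure_subset_iff.2 hsub hmem
  rw [Set.mem_setOf_eq, hΦ] at hfin
  exact hfin

/-- **The free field of mass `m > 0` has the OS mass gap `m`** (Glimm–Jaffe Thm. 6.2.4: the free
Hamiltonian is `dΓ(μ)`, `μ = (−Δ⃗ + m²)^{1/2} ≥ m`, so `σ(H) ⊆ {0} ∪ [m, ∞)` with `Ω` the unique vacuum;
Euclidean form: ALL truncated Schwinger functions `𝔖ₙ₊ₖ(ΘF* ⊗ T_t G) − 𝔖ₙ(ΘF*) 𝔖ₖ(G)` of
positive-time `F, G` decay like `C(F, G) e^{−mt}`). For any Euclidean-covariant Schwinger family `𝔖`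
of a free field measure. [cite: GlimmJaffeQP1987, Thm. 6.2.4 and Cor. 6.2.7] -/
theorem _root_.Literature.MathematicalPhysics.QuantumLattice.IsFreeField.massGapOS (hm : 0 < m)
    (h : IsFreeField m μ) (hS : IsSchwingerFamilyOf μ S) (hE1 : S.IsEuclideanCovariant) :
    S.MassGapOS m := by
  refine SchwingerFamily.massGapOS_of_positiveTime hm fun n k F G hF hG => ?_
  refine ⟨4 * Real.sqrt (S.sqNorm n F) * Real.sqrt (S.sqNorm k G), fun t ht H hH => ?_⟩
  have hH' : H = (osAdjoint F).appendTensor (translateMulti (EuclideanSpace.single 0 t) G) := by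
    ext x; rw [hH x, SchwartzMap.appendTensor_apply]
  rw [hH']
  have hspan : ∀ P ∈ Submodule.span ℂ (positiveTensorProducts (d := d) n),
      ∀ Q ∈ Submodule.span ℂ (positiveTensorProducts (d := d) k), ∀ t : ℝ, 0 ≤ t →
        ‖S (n + k) ((osAdjoint P).appendTensor (translateMulti (EuclideanSpace.single 0 t) Q)) -
            S n (osAdjoint P) * S k Q‖ ≤
          Real.exp (-m * t) * ((4 * Real.sqrt (S.sqNorm n P)) * Real.sqrt (S.sqNorm k Q)) := by
    intro P hP Q hQ t ht
    obtain ⟨N, w, f, hf, rfl⟩ := exists_tensorSum_of_mem_span hP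
    obtain ⟨N', w', g, hg, rfl⟩ := exists_tensorSum_of_mem_span hQ
    exact h.norm_truncated_tensorSum_le hm hS hE1 w w' hf hg ht
  have hb := S.truncated_bound_of_span (Δ := m) (fun P => 4 * Real.sqrt (S.sqNorm n P))
    (fun Q => Real.sqrt (S.sqNorm k Q))
    (continuous_const.mul (Real.continuous_sqrt.comp (S.continuous_sqNorm n)))
    (Real.continuous_sqrt.comp (S.continuous_sqNorm k)) hspan hF hG ht
  calc _ ≤ _ := hb
    _ = _ := by ring

/-- **The free field has the full-spectrum mass gap `m` in the labelled (`OSData`) form**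
`S.toLabelled.HasMassGap m`. [cite: GlimmJaffeQP1987, Thm. 6.2.4 and Cor. 6.2.7] -/
theorem _root_.Literature.MathematicalPhysics.QuantumLattice.IsFreeField.hasMassGap_toLabelled (hm : 0 < m)
    (h : IsFreeField m μ) (hS : IsSchwingerFamilyOf μ S) (hE1 : S.IsEuclideanCovariant) :
    S.toLabelled.HasMassGap m :=
  ((SchwingerFamily.massGapOS_iff_hasMassGap S m).1 (h.massGapOS hm hS hE1)).2

end SchwingerSide

end Literature.MathematicalPhysics.QuantumFieldTheory
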